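import Literature.MathematicalPhysics.QuantumFieldTheory.Balaban1983to89.B9Eq3105OfLocalInverse
import Literature.MathematicalPhysics.QuantumFieldTheory.Balaban1983to89.B9Thm310GTorusRegularCover

/-!
# `Balaban1983to89.B9Thm310GOfLocalInverse` — T. Bałaban, *Propagators for lattice gauge theories in a background field*, Commun. Math. Phys. **99** (1985)
# 389–434 [Balaban1985BackgroundPropagators], Theorem 3.10 ⇒ Theorem 3.3 (3.42) for `G(U) = Δ_a(U)⁻¹` WITH THE CUBE LETTERS AN ARBITRARY FAMILY `O_□`
# SATISFYING THE LOCAL-INVERSE LAWS UP TO DISPLAYED DEFECTS — the bond-sector twin of p21's `B9Thm37GpTorusRegularFinal.eBlock_kernelFamilySInv_Gp_of_localInverse`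
# (cell `lit-balaban`, sub-row G-B9-LETTERS, module M5.7, the (QB1) re-cut of FILES 1-B ∕ 2-B ∕ 3-B ∕ 6-B; seat p38 gen 41)

statement-level skeleton of published theorems with citation tags; proofs where landed; nothing here is a claim about the Yang–Mills mass gap

CITATION HEADER (lean-in-tree rule).  B9 = T. Bałaban, *Propagators for lattice gauge theories in a background field*, Commun. Math. Phys. **99** (1985)
389–434 (PDF held: `paper:balaban1985-cmp99-background-propagators`, journal page = PDF page + 388).  p. 414 (3.105) «Δ_aG₀ = I − Σ_□K(h_□)G_□h_□ −
Σ_□(1 − ζ_□̃)DPD*h_□G_□h_□ − Σ_□ζ_□̃(DPD* − DP_□D*)h_□G_□h_□ − Σ_□ζ_□̃P_{□,1}(∂h_□)G_□h_□ = I − R», p. 414 l. 33–35 «The operator K(h_□)G_□h_□ satisfies the inequality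
(3.89), hence it is small», (3.106) p. 414 «For M sufficiently large this implies G = G₀(I − R)⁻¹»; p. 416 «Theorem 3.10 implies Theorem 3.3»; p. 399 Theorem 3.3
«the operator G(U) (a = 1) satisfies the inequalities (3.42)–(3.47) … The constants in the inequalities depend on d and L only»; (3.42) p. 397; (3.87) p. 409
«G₀ = Σ_{□∈𝒟} h_□G_□h_□»; p. 409 l. 3–5 «The operators constructed for this sequence, which we denote by G′_□(U), C_□(U) = (Q(U)G′_□²(U)Q*(U))⁻¹, G_□(U), satisfy
all the inequalities of Theorems 3.1–3.3 correspondingly»; p. 410 l. 2–3 «This theorem follows simply from Corollary 3.6 holding for all G′_□, □ ∈ 𝒟, from the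
bound (3.89) and Lemma 2.1.»; p. 410 l. 14–15 «A propagator G′_□ depends on U restricted to Ω₀(□) ⊂ □̃⁵, and the operator K(h_□) is semi-local»; (3.89) p. 409
«|(K(h_□)G′_□h_□λ)(x)| ≦ O(M⁻¹)e^{−δ₀(Lʲη)⁻¹|y−y′|}|λ|» (x ∈ Δ(y), supp λ ⊂ Δ(y′), y, y′ ∈ □ ∈ 𝒟_j).  [4] = [Balaban1984PropagatorsII] (2.51)–(2.52) p. 232 («A summation
preserves it also»), Prop. 2.2 (2.64)–(2.67) p. 234, Lemma 2.1 (2.61) p. 234.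
Rows B9.Thm3.10 × B9.Thm3.3 × B9.Eq3.105 × B9.Eq3.87 (cells only; no row head changes).

WHY THIS FILE (the (QB1) re-cut; cell HOME∕INBOX 2026-08-28 11:25:24Z (F1-B), 11:28:22Z (c)–(d), 11:46:58Z «(QB1) ANSWER: YES»).  FILES 1-B ∕ 2-B ∕ 3-B ∕ 6-B of
module M5.7 (`B9Thm310GTorusRegular` ∕ `…Entries` ∕ `B9Thm310CommutatorSum` ∕ `B9Thm310GTorusRegularCover`) fix the cube letter to r05's WHOLE-TORUS
`G_□(U₁) = GACubeY i □ parS parB (cfg U₁) = Δ_{a,□}(U₁)⁻¹` and display `hinvC : IsUnit (Δ_{a,□}(U₁))` at the class background — an invertibility with no proof road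
at a background that is only class-regular off the cube, while print's `G_□` is the propagator of the LOCALISED cube sequence depending on `U` restricted to
`Ω₀(□) ⊂ □̃⁵` (p. 410 l. 14–15).  THIS FILE re-runs the four files with the cube letters an ARBITRARY family `Oc : cubes → BondOpY 𝔸 i`, the local projection
letters `Pl_□` (print's `DP_□D*`) and their (3.101) commutators `P1l_□` ARBITRARY, and the two local-inverse laws entering UP TO DISPLAYED DEFECTS `E_□`, `E♯_□`
(`M_{h_□}(Δ_loc − Pl_□)O_□M_{h_□} = M_{h_□}² − E_□`, `M_{h_□}O_□(Δ_loc − Pl_□)M_{h_□} = M_{h_□}² − E♯_□`; the identities are `B9Eq3105OfLocalInverse.eq3105_conj_defect` ∕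
`eq3105T_conj_defect`): the defect families `Σ_□E_□`, `Σ_□E♯_□` ride as a FIFTH family inside the displayed remainder majorants (`hR` ∕ `hrest` ∕ `hV`).  Every
ENGINE is reused BY NAME, being already letter-generic: `B9Thm310GTorusRegular.thm310_entry1` ∕ `hT_of_eBlockInvB_cube`, `…Entries.thm310_leftEntry` ∕
`thm310_rightEntry`, `B9CubeLettersInvWriteDictB.eBlock_kernelFamilyBInv_of_hasMajorant`, this seat's E′₄-loc `…LocOfInv.hasMajorant_conj_KhBY_hTY_of_eBlockInvB_fac_loc`
with E′₅'s data; only the `GACubeY`-pinned wrappers are twinned.  For print's letters and for r05's `GACubeY` the defects vanish (`B9Eq3105OfLocalInverse.hdef_GACubeY` ∕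
`hdefT_GACubeY`); for a both-sided cut transported letter `χ_□𝒰⁻¹G_□(Ṽ_□)𝒰χ_□` (the next G-hand's letter, p02 memo v1.4 §B (i)) they are of size
`e^{−δ₀·d(supp h_□, supp(1 − χ_□))}` because `Δ_{a,□}` is non-local through `D R_□ D*` — an (R)-DESIGN TERM, NOT IN PRINT (bond twin of cell GAPS G-B9-p21-01).

WHAT IS PROVED (all `theorem`s, 0 `def`, 0 sorry, 0 new named facts).
* §1 ★ `hasMajorant_conj_GAY_of_cubes_ofLocalInverse` — 1-B §2 at generic letters: the (3.42)₁ majorant of `conj b G(U)` from the cube terms' localized majorants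
  `hT`, the five-family remainder majorant `hR`, `IsUnit Δ_a(U)`, the defect law `hdef`.
* §2 ★ `hasMajorant_left_conj_GAY_of_cubes_ofLocalInverse`, ★ `hasMajorant_right_conj_GAY_of_cubes_ofLocalInverse` — 2-B §2 at generic letters (right entry with the
  transposed defect law `hdefT` and the five-family transposed remainder `hV`).
* §3 ★★ `eBlock_kernelFamilyBInv_GAY_of_cubes_ofLocalInverse` — 2-B §3 at generic letters: all four sup-entries (3.42) as
  `EBlock (kernelFamilyBInv i B cfg (GAY i parS parB Gp) par) (M₂(Σ‖b_j‖)·Bc) ((1−2α)δ₀) U₁`.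
* §4 ★ `hasMajorant_sum_conj_KhBY_Oc_hTY` — 3-B §3 at generic letters: the first family `Σ_□K(h_□)O_□(U₁)h_□` has the majorant `N′·θ₀M⁻¹·e^{−δ₀d}` from the letters'
  (3.42) blocks `hE`, bi-contractivity and one plaquette datum, uniformly in `k`.
* §5 ★★ `hasMajorant_conj_GAY_of_localInverse`, ★★ `e0_kernelFamilyBInv_GAY_le_of_localInverse` — 6-B §2 at generic letters (the cover of record, first family
  discharged, `hT` read off `hE`).
* §6 ★★★ `eBlock_kernelFamilyBInv_GAY_of_localInverse` — 6-B §3 at generic letters: the consumer-facing block with `hE`, `hdef`∕`hdefT`, `hrest` (families 2–5),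
  `hV` (transposed families 1–5), the cube Leibniz majorants `hTE`∕`hTF`∕`hTL`, `hinvU`, bi-contractivity, plaquette datum, (2.61)∕(2.63), two smallness conditions.

HONEST SCOPE.  DISPLAYED (hypotheses, none a cited fact): `hE` (Cor. 3.6 ∕ Thm 3.3 blocks of every cube letter `O_□` at `U₁` — the M5.1b-G hand's output for its
letter), the defect laws `hdef`∕`hdefT` (algebra of that letter; exact for print's), `hrest`∕`hR` and `hV` (families 2–4 of `R`: p. 415's walk re-expansion of `P`,
(3.101) — cell GAPS G-B9-05∕06a∕07 — plus the defect family), `hinvU : IsUnit Δ_a(U₁)` (Thm 3.3's regime; M5.3 lineage), bi-contractivity `hU`∕`hT` (unitary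
fibre), the plaquette datum `hW` (print's (3.35) via `…DataOfPlaquettes.plaquetteDefect_of_reg335P`), `η = |c_f|⁻¹`, `0 ≤ b₁`, [4] Lemma 2.1 (`h261`, `h263`),
the located smallness conditions («M sufficiently large»).  Corner-free members (a section `ιB` of `β`).  Sup-entries (3.42) only.  Nothing continuum ∕ OS ∕
mass gap ∕ Clay; YM mass gap NOT proved by any of this (Track A conditional rung).  `--supports stmt-QuantumFields-19200`.
RELATED, NOT DUPLICATED (searched 2026-08-28: `lean search 'ofLocalInverse|of_localInverse' --decl` → site sector only (`B9Thm37GpTorusRegularFinal`, `B9Thm37GpAtCoverLarge`,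
`B9Cor36GpCubeLocLetter`, `B9Thm39CinvOfEBlock`); bond sector ∅): FILES 1-B ∕ 2-B ∕ 3-B ∕ 6-B stay for their consumers (the `GACubeY` instance).
-/

noncomputable section

namespace Literature.MathematicalPhysics.QuantumFieldTheory.Balaban1983to89.B9Thm310GOfLocalInverse

open Node00 B9CubeLettersInvReadings
open B9CubeLettersInvWriteDictB (eBlock_kernelFamilyBInv_of_hasMajorant)
open B9Thm37GpTorusRegularEntries (kernel_mono)
open B6GlobalChartV1 (blkV1)
open B6Ineq2142KLevelV1 (β)
open B6KLevelCensusIndexV1 (KIdx)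
open B6Cover236MultiLevelBlocks (cubes)
open B6Geom246MultiLevelBox (bset blkOf)
open B6Geom246MultiLevelTorus (bondT)
open B6Partition118KLevelTorusCentral (QT blkOf_mem_QT_of_hT_ne_zero)
open B6RandomWalk (HasMajorant Triangle254 Ineq261 Ineq263 hasMajorant_mono hasMajorant_add c1_nonneg)
open B9Thm34Ext (toB6 toB6_dist)
open B9FromB6 (EBlock)
open B9GeoNormsKLevelV1 (geo9K)
open B9Eq352DivFormLetters (conj)
open B9Thm37Sum (mulOp hasMajorant_finsetSum)
open B9Thm37CubeCoverCommutators (cutMulY hTY)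
open B9Thm37CubeCoverCommutatorSizes (side_conditions four_le_P')
open B9Eq3104CutoffCommutators (hBdY KhBY DPDsY deltaLocY)
open B9Eq3105Coords (conj_GAY_mul_deltaAY conj_deltaAY_mul_GAY)
open B9Eq3105OfLocalInverse (eq3105_conj_defect eq3105T_conj_defect)
open B9Thm310GTorusRegular (thm310_entry1 hT_of_eBlockInvB_cube e0_kernelFamilyBInv_le_of_hasMajorant)
open B9Thm310GTorusRegularEntries (thm310_leftEntry thm310_rightEntry)
open B9Thm310CommutatorBound389B (theta389B theta389B_nonneg b1_pos)
open B9Thm310CommutatorBound389BLocOfInv (hasMajorant_conj_KhBY_hTY_of_eBlockInvB_fac_loc)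
open B9Thm310CommutatorDataOfPlaquettes (hP_of_plaquettes hRe_of_bicontractive hKc_of_plaquettes hI_of_plaquettes)
open B9Thm310CommutatorSum (sum_indicator_nearQT_le)
open B9Thm37GpTorusRegularCubes (SQT hcnt_SQT)
open Node00.OpsYNablaBridge (chartY)
open scoped Matrix

variable {d ℓ : ℕ} {hd : 1 ≤ d + 1} {hL : Odd (ℓ + 1) ∧ 1 < ℓ + 1} {b₀ b₁ : ℝ}
variable {𝔸 : Type} [NormedRing 𝔸] [NormedAlgebra ℂ 𝔸] [CompleteSpace 𝔸]
variable {ι : Type} [Fintype ι] [DecidableEq ι]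
variable (i : KIdx d ℓ hd hL b₀ b₁) (b : Module.Basis ι ℝ 𝔸)
variable [Fintype (geo9K i).Site] [DecidableEq (geo9K i).Site] {Rr : ℝ} {Hp : Prop}
variable (ιB : BlkY i → IBondY i)

/-! ## §1 (3.42)₁ majorant of `conj b G(U)` from the cube terms at generic letters (1-B §2 re-run) -/

section Entry1Cubes

/-- ★ **THEOREM 3.10 ⇒ THE FIRST (3.42) MAJORANT FOR def-Y's `G(U) = Δ_a(U)⁻¹`, GENERIC CUBE LETTERS**: for def-Y's `Δ_a(U)` invertible (`hinvU`), a choice `ζ_□̃ = 1` on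
`supp h_□`, ANY cube letters `O_□`, local projection letters `Pl_□` with (3.101) commutators `P1l_□` (`hP1`), the LEFT local-inverse law up to the defect `E_□`
(`hdef`), the cube terms `h_□·conj b O_□·h_□` with localized majorants `1_{S_□}·B₀ℓ²e^{−δ₀d}` (`hT`) of overlap ≤ `N` (`hcnt`), the TOTAL remainder — the four printed
families and the defect family `Σ_□ conj b E_□` — with the majorant `Θ·e^{−δ₀d}` (`hR`), [4] Lemma 2.1 at exponent `α` and `Θc₁(α) < 1`: `conj b G(U)` has the
majorant `N·B₀c₁(α)(1 − Θc₁(α))⁻¹·ℓ(a)²·e^{−(1−α)δ₀d(a,a′)}`. DEFECT LABEL: the defect family `Σ_□E_□` (resp. `Σ_□E♯_□`) is an (R)-design term, NOT in print; `= 0` for print's `G_□ = (Δ_{loc,□} − DP_□D*)⁻¹` on the cube sequence (p. 409 l. 3–5) and for r05's `GACubeY` letters. [cite: Balaban1985BackgroundPropagators, Thm 3.10 p.416 + (3.105)–(3.106) p.414, (3.87) p.409, (3.27) p.395; Balaban1984PropagatorsII, Prop. 2.2 (2.64)–(2.66) p.234] -/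
theorem hasMajorant_conj_GAY_of_cubes_ofLocalInverse (d' : ℕ) {δ₀ α Θ B₀ N : ℝ}
    (parS : SiteParY 𝔸 i) (parB : BondParY 𝔸 i) (Gp : SiteOpY 𝔸 i) (U : CfgY 𝔸 i)
    (ζ : ↥(cubes i.D.toDomains) → SiteY i → ℝ) (hζ : ∀ c z, hTY i c z ≠ 0 → ζ c z = 1)
    (Oc : ↥(cubes i.D.toDomains) → BondOpY 𝔸 i) (Pl P1l E : ↥(cubes i.D.toDomains) → Module.End ℂ (FBondY i → 𝔸))
    (hP1 : ∀ c, Pl c * cutMulY (hBdY i (hTY i c)) = cutMulY (hBdY i (hTY i c)) * Pl c + P1l c)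
    (hdef : ∀ c, cutMulY (hBdY i (hTY i c)) * (deltaLocY i parB U - Pl c) * Oc c U * cutMulY (hBdY i (hTY i c)) =
      cutMulY (hBdY i (hTY i c)) * cutMulY (hBdY i (hTY i c)) - E c)
    (hinvU : IsUnit (deltaAY i parS parB Gp U))
    (S : ↥(cubes i.D.toDomains) → Finset (geo9K i).Site)
    (hB₀ : 0 ≤ B₀) (hΘ : 0 ≤ Θ) (hN : 0 ≤ N) (hαδ : 0 ≤ (1 - α) * δ₀)
    (htri : Triangle254 (toB6 (geo9K i) Rr Hp)) (hrefl : ∀ y : (geo9K i).Site, (geo9K i).dist y y = 0)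
    (hdnn : ∀ y y' : (geo9K i).Site, 0 ≤ (geo9K i).dist y y')
    (h261 : Ineq261 d' (toB6 (geo9K i) Rr Hp) δ₀ α) (h263 : Ineq263 d' (toB6 (geo9K i) Rr Hp) δ₀ α)
    (hsmall : Θ * B6.c1 d' δ₀ α < 1)
    (hT : ∀ c, HasMajorant (g := toB6 (geo9K i) Rr Hp) (fun p : FBondY i × ι => ιB (blkV1 i.hN i.D p.1))
      (mulOp (fun p : FBondY i × ι => hBdY i (hTY i c) p.1) * conj b ((Oc c U).restrictScalars ℝ) *
        mulOp (fun p : FBondY i × ι => hBdY i (hTY i c) p.1))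
      (fun a a' => if a ∈ S c then B₀ * (geo9K i).len a ^ 2 * Real.exp (-(δ₀ * (geo9K i).dist a a')) else 0))
    (hcnt : ∀ a : (geo9K i).Site, (∑ c, if a ∈ S c then (1 : ℝ) else 0) ≤ N)
    (hR : HasMajorant (g := toB6 (geo9K i) Rr Hp) (fun p : FBondY i × ι => ιB (blkV1 i.hN i.D p.1))
      ((∑ c, conj b ((KhBY i (hTY i c) parB U * Oc c U * cutMulY (hBdY i (hTY i c))).restrictScalars ℝ))
        + ∑ c, conj b (((1 - cutMulY (hBdY i (ζ c))) * DPDsY i parS Gp U *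
            (cutMulY (hBdY i (hTY i c)) * Oc c U * cutMulY (hBdY i (hTY i c)))).restrictScalars ℝ)
        + ∑ c, conj b ((cutMulY (hBdY i (ζ c)) * (DPDsY i parS Gp U - Pl c) *
            (cutMulY (hBdY i (hTY i c)) * Oc c U * cutMulY (hBdY i (hTY i c)))).restrictScalars ℝ)
        + ∑ c, conj b ((cutMulY (hBdY i (ζ c)) * P1l c * Oc c U * cutMulY (hBdY i (hTY i c))).restrictScalars ℝ)
        + ∑ c, conj b ((E c).restrictScalars ℝ))
      (fun a a' => Θ * Real.exp (-(δ₀ * (geo9K i).dist a a')))) :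
    HasMajorant (g := toB6 (geo9K i) Rr Hp) (fun p : FBondY i × ι => ιB (blkV1 i.hN i.D p.1))
      (conj b ((GAY i parS parB Gp U).restrictScalars ℝ))
      (fun a a' => N * B₀ * B6.c1 d' δ₀ α * (1 - Θ * B6.c1 d' δ₀ α)⁻¹ * (geo9K i).len a ^ 2 *
        Real.exp (-((1 - α) * δ₀ * (geo9K i).dist a a'))) :=
  thm310_entry1 (fun p : FBondY i × ι => ιB (blkV1 i.hN i.D p.1)) d' δ₀ α Θ B₀ N S
    (fun c => mulOp (fun p : FBondY i × ι => hBdY i (hTY i c) p.1) * conj b ((Oc c U).restrictScalars ℝ) *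
      mulOp (fun p : FBondY i × ι => hBdY i (hTY i c) p.1))
    hB₀ hΘ hN hαδ htri hrefl hdnn h261 h263 hsmall hT hcnt hR (conj_GAY_mul_deltaAY i b parS parB Gp U hinvU)
    (eq3105_conj_defect i b parS parB Gp U ζ hζ (fun c => Oc c U) Pl P1l E hP1 hdef)

end Entry1Cubes

/-! ## §2 The left and right entries at generic letters (2-B §2 re-run) -/

section EntriesCubes

omit [DecidableEq (geo9K i).Site] in
/-- ★ **A LEFT ENTRY OF (3.42) FOR def-Y's `G(U)`, GENERIC CUBE LETTERS, ANY REAL-COORDINATE LEFT FACTOR `E_b`** (entries (3.42)₂ ∕ (3.42)₄): block majorants `K_{E,□}` of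
`E_b·(h_□·conj b O_□·h_□)` summing to `≤ A·W(a)e^{−δ₀d}` (`hTE`, `hKE`), the five-family remainder with `Θ·e^{−δ₀d}` (`hR`), `IsUnit Δ_a(U)`, the defect law `hdef`,
[4] Lemma 2.1, `Θc₁(α) < 1`: `E_b·conj b G(U)` has the majorant `A·c₁(α)(1 − Θc₁(α))⁻¹·W(a)·e^{−(1−α)δ₀d}`.
DEFECT LABEL: the defect family `Σ_□E_□` (resp. `Σ_□E♯_□`) is an (R)-design term, NOT in print; `= 0` for print's `G_□ = (Δ_{loc,□} − DP_□D*)⁻¹` on the cube sequence (p. 409 l. 3–5) and for r05's `GACubeY` letters. [cite: Balaban1985BackgroundPropagators, Thm 3.10 p.416 + (3.105)–(3.106) p.414 ⇒ Thm 3.3 (3.42)₂,₄ pp.397–399; Balaban1984PropagatorsII, Prop. 2.2 (2.67) p.234] -/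
theorem hasMajorant_left_conj_GAY_of_cubes_ofLocalInverse (d' : ℕ) {δ₀ α Θ A : ℝ}
    (parS : SiteParY 𝔸 i) (parB : BondParY 𝔸 i) (Gp : SiteOpY 𝔸 i) (U : CfgY 𝔸 i)
    (ζ : ↥(cubes i.D.toDomains) → SiteY i → ℝ) (hζ : ∀ c z, hTY i c z ≠ 0 → ζ c z = 1)
    (Oc : ↥(cubes i.D.toDomains) → BondOpY 𝔸 i) (Pl P1l E : ↥(cubes i.D.toDomains) → Module.End ℂ (FBondY i → 𝔸))
    (hP1 : ∀ c, Pl c * cutMulY (hBdY i (hTY i c)) = cutMulY (hBdY i (hTY i c)) * Pl c + P1l c)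
    (hdef : ∀ c, cutMulY (hBdY i (hTY i c)) * (deltaLocY i parB U - Pl c) * Oc c U * cutMulY (hBdY i (hTY i c)) =
      cutMulY (hBdY i (hTY i c)) * cutMulY (hBdY i (hTY i c)) - E c)
    (hinvU : IsUnit (deltaAY i parS parB Gp U))
    (Eb : Module.End ℝ (FBondY i × ι → ℝ)) (W : (geo9K i).Site → ℝ) (KE : ↥(cubes i.D.toDomains) → (geo9K i).Site → (geo9K i).Site → ℝ)
    (hA : 0 ≤ A) (hW : ∀ a, 0 ≤ W a) (hΘ : 0 ≤ Θ) (hαδ : 0 ≤ (1 - α) * δ₀)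
    (htri : Triangle254 (toB6 (geo9K i) Rr Hp)) (hrefl : ∀ y : (geo9K i).Site, (geo9K i).dist y y = 0)
    (hdnn : ∀ y y' : (geo9K i).Site, 0 ≤ (geo9K i).dist y y')
    (h261 : Ineq261 d' (toB6 (geo9K i) Rr Hp) δ₀ α) (h263 : Ineq263 d' (toB6 (geo9K i) Rr Hp) δ₀ α)
    (hsmall : Θ * B6.c1 d' δ₀ α < 1)
    (hTE : ∀ c, HasMajorant (g := toB6 (geo9K i) Rr Hp) (fun p : FBondY i × ι => ιB (blkV1 i.hN i.D p.1))
      (Eb * (mulOp (fun p : FBondY i × ι => hBdY i (hTY i c) p.1) * conj b ((Oc c U).restrictScalars ℝ) *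
        mulOp (fun p : FBondY i × ι => hBdY i (hTY i c) p.1))) (KE c))
    (hKE : ∀ a a', (∑ c, KE c a a') ≤ A * W a * Real.exp (-(δ₀ * (geo9K i).dist a a')))
    (hR : HasMajorant (g := toB6 (geo9K i) Rr Hp) (fun p : FBondY i × ι => ιB (blkV1 i.hN i.D p.1))
      ((∑ c, conj b ((KhBY i (hTY i c) parB U * Oc c U * cutMulY (hBdY i (hTY i c))).restrictScalars ℝ))
        + ∑ c, conj b (((1 - cutMulY (hBdY i (ζ c))) * DPDsY i parS Gp U *
            (cutMulY (hBdY i (hTY i c)) * Oc c U * cutMulY (hBdY i (hTY i c)))).restrictScalars ℝ)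
        + ∑ c, conj b ((cutMulY (hBdY i (ζ c)) * (DPDsY i parS Gp U - Pl c) *
            (cutMulY (hBdY i (hTY i c)) * Oc c U * cutMulY (hBdY i (hTY i c)))).restrictScalars ℝ)
        + ∑ c, conj b ((cutMulY (hBdY i (ζ c)) * P1l c * Oc c U * cutMulY (hBdY i (hTY i c))).restrictScalars ℝ)
        + ∑ c, conj b ((E c).restrictScalars ℝ))
      (fun a a' => Θ * Real.exp (-(δ₀ * (geo9K i).dist a a')))) :
    HasMajorant (g := toB6 (geo9K i) Rr Hp) (fun p : FBondY i × ι => ιB (blkV1 i.hN i.D p.1))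
      (Eb * conj b ((GAY i parS parB Gp U).restrictScalars ℝ))
      (fun a a' => A * B6.c1 d' δ₀ α * (1 - Θ * B6.c1 d' δ₀ α)⁻¹ * W a * Real.exp (-((1 - α) * δ₀ * (geo9K i).dist a a'))) :=
  thm310_leftEntry (fun p : FBondY i × ι => ιB (blkV1 i.hN i.D p.1)) d' δ₀ α Θ A
    (fun c => mulOp (fun p : FBondY i × ι => hBdY i (hTY i c) p.1) * conj b ((Oc c U).restrictScalars ℝ) *
      mulOp (fun p : FBondY i × ι => hBdY i (hTY i c) p.1))
    Eb W KE hA hW hΘ hαδ htri hrefl hdnn h261 h263 hsmall hTE hKE hR (conj_GAY_mul_deltaAY i b parS parB Gp U hinvU)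
    (eq3105_conj_defect i b parS parB Gp U ζ hζ (fun c => Oc c U) Pl P1l E hP1 hdef)

omit [DecidableEq (geo9K i).Site] in
/-- ★ **THE RIGHT ENTRY (3.42)₃ FOR def-Y's `G(U)`, GENERIC CUBE LETTERS, ANY REAL-COORDINATE RIGHT FACTOR `F_b`**: block majorants `K_{F,□}` of `(h_□·conj b O_□·h_□)·F_b`
summing to `≤ A·ℓ(a)e^{−δ₀d}` (`hTF`, `hKF`); the TRANSPOSED remainder — the four transposed families of `B9Eq3105OfLocalInverse.eq3105T_conj_defect` and the defect family
`Σ_□ conj b E♯_□` — with the scale-weighted majorant `θ_V·ℓ(a)ℓ(a′)⁻¹e^{−δ₀d}` (`hV`); the RIGHT defect law `hdefT`; `IsUnit Δ_a(U)`; [4] Lemma 2.1; `θ_Vc₁(α) < 1`: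
`conj b G(U)·F_b` has the majorant `A·c₁(α)(1 − θ_Vc₁(α))⁻¹·ℓ(a)·e^{−(1−2α)δ₀d}`.
DEFECT LABEL: the defect family `Σ_□E_□` (resp. `Σ_□E♯_□`) is an (R)-design term, NOT in print; `= 0` for print's `G_□ = (Δ_{loc,□} − DP_□D*)⁻¹` on the cube sequence (p. 409 l. 3–5) and for r05's `GACubeY` letters. [cite: Balaban1985BackgroundPropagators, Thm 3.10 p.416 + (3.105) p.414 read transposed ⇒ Thm 3.3 (3.42)₃ pp.397–399; Balaban1984PropagatorsII, Prop. 2.2 (2.67) p.234] -/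
theorem hasMajorant_right_conj_GAY_of_cubes_ofLocalInverse (d' : ℕ) {δ₀ α θV A : ℝ}
    (parS : SiteParY 𝔸 i) (parB : BondParY 𝔸 i) (Gp : SiteOpY 𝔸 i) (U : CfgY 𝔸 i)
    (ζ : ↥(cubes i.D.toDomains) → SiteY i → ℝ) (hζ : ∀ c z, hTY i c z ≠ 0 → ζ c z = 1)
    (Oc : ↥(cubes i.D.toDomains) → BondOpY 𝔸 i) (Pl P1l Et : ↥(cubes i.D.toDomains) → Module.End ℂ (FBondY i → 𝔸))
    (hP1 : ∀ c, Pl c * cutMulY (hBdY i (hTY i c)) = cutMulY (hBdY i (hTY i c)) * Pl c + P1l c)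
    (hdefT : ∀ c, cutMulY (hBdY i (hTY i c)) * Oc c U * (deltaLocY i parB U - Pl c) * cutMulY (hBdY i (hTY i c)) =
      cutMulY (hBdY i (hTY i c)) * cutMulY (hBdY i (hTY i c)) - Et c)
    (hinvU : IsUnit (deltaAY i parS parB Gp U))
    (Fb : Module.End ℝ (FBondY i × ι → ℝ)) (KF : ↥(cubes i.D.toDomains) → (geo9K i).Site → (geo9K i).Site → ℝ)
    (hA : 0 ≤ A) (hθV : 0 ≤ θV) (hαδ : 0 ≤ α * δ₀) (hαδ2 : 0 ≤ (1 - 2 * α) * δ₀)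
    (h261 : Ineq261 d' (toB6 (geo9K i) Rr Hp) δ₀ α) (h263 : Ineq263 d' (toB6 (geo9K i) Rr Hp) δ₀ α)
    (hsmall : θV * B6.c1 d' δ₀ α < 1)
    (hTF : ∀ c, HasMajorant (g := toB6 (geo9K i) Rr Hp) (fun p : FBondY i × ι => ιB (blkV1 i.hN i.D p.1))
      ((mulOp (fun p : FBondY i × ι => hBdY i (hTY i c) p.1) * conj b ((Oc c U).restrictScalars ℝ) *
        mulOp (fun p : FBondY i × ι => hBdY i (hTY i c) p.1)) * Fb) (KF c))
    (hKF : ∀ a a', (∑ c, KF c a a') ≤ A * (geo9K i).len a * Real.exp (-(δ₀ * (geo9K i).dist a a')))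
    (hV : HasMajorant (g := toB6 (geo9K i) Rr Hp) (fun p : FBondY i × ι => ιB (blkV1 i.hN i.D p.1))
      (-(∑ c, conj b ((cutMulY (hBdY i (hTY i c)) * Oc c U * KhBY i (hTY i c) parB U).restrictScalars ℝ))
        - ∑ c, conj b ((cutMulY (hBdY i (hTY i c)) * Oc c U * P1l c).restrictScalars ℝ)
        + ∑ c, conj b ((cutMulY (hBdY i (hTY i c)) * Oc c U * cutMulY (hBdY i (hTY i c)) *
            (cutMulY (hBdY i (ζ c)) * (DPDsY i parS Gp U - Pl c))).restrictScalars ℝ)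
        + ∑ c, conj b ((cutMulY (hBdY i (hTY i c)) * Oc c U * cutMulY (hBdY i (hTY i c)) *
            ((1 - cutMulY (hBdY i (ζ c))) * DPDsY i parS Gp U)).restrictScalars ℝ)
        + ∑ c, conj b ((Et c).restrictScalars ℝ))
      (fun a a' => θV * (geo9K i).len a * ((geo9K i).len a')⁻¹ * Real.exp (-(δ₀ * (geo9K i).dist a a')))) :
    HasMajorant (g := toB6 (geo9K i) Rr Hp) (fun p : FBondY i × ι => ιB (blkV1 i.hN i.D p.1))
      (conj b ((GAY i parS parB Gp U).restrictScalars ℝ) * Fb)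
      (fun a a' => A * B6.c1 d' δ₀ α * (1 - θV * B6.c1 d' δ₀ α)⁻¹ * (geo9K i).len a *
        Real.exp (-((1 - 2 * α) * δ₀ * (geo9K i).dist a a'))) :=
  thm310_rightEntry (fun p : FBondY i × ι => ιB (blkV1 i.hN i.D p.1)) d' δ₀ α θV A
    (fun c => mulOp (fun p : FBondY i × ι => hBdY i (hTY i c) p.1) * conj b ((Oc c U).restrictScalars ℝ) *
      mulOp (fun p : FBondY i × ι => hBdY i (hTY i c) p.1))
    Fb KF hA hθV hαδ hαδ2 ((B9Thm34Ext.triangle254_toB6_iff (geo9K i) Rr Hp).2 (B9GeoLemma21KLevelV1.geo9K_dist_triangle i))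
    (B9GeoLemma21KLevelV1.geo9K_dist_self i) (B9GeoLemma21KLevelV1.geo9K_dist_comm i) (B9GeoLemma21KLevelV1.geo9K_dist_nonneg' i)
    (B9GeoLemma21KLevelV1.geo9K_len_pos i) h261 h263 hsmall hTF hKF hV (conj_deltaAY_mul_GAY i b parS parB Gp U hinvU)
    (eq3105T_conj_defect i b parS parB Gp U ζ hζ (fun c => Oc c U) Pl P1l Et hP1 hdefT)

end EntriesCubes

/-! ## §3 All four entries at generic letters, written over the invariant class (2-B §3 re-run) -/

section AssemblyCubes

variable {B : B9.Backgrounds} (cfg : B.Cfg → CfgY 𝔸 i) (par : BondParY 𝔸 i) {U₁ : B.Cfg}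

/-- ★★ **THEOREM 3.10 ⇒ ALL FOUR INEQUALITIES (3.42) OF THEOREM 3.3 FOR def-Y's `G(U)`, GENERIC CUBE LETTERS, AS THE (3.42) BLOCK OF THE READING
`kernelFamilyBInv i B cfg (GAY i parS parB Gp) par` OVER THE INVARIANT CLASS AT `U₁`** — 2-B §3 re-run: §1 for entry 1 (inputs `hT`∕`hcnt`), §2 left for the `d + 1`
forward entries and the Laplacian entry (`hTE`∕`hKE`, `hTL`∕`hKL`), §2 right for the `d + 1` backward entries (`hTF`∕`hKF`, the transposed remainder's `hV` with its
defect family), the remainder's `hR` with its defect family, the two defect laws `hdef`∕`hdefT`, `IsUnit Δ_a(U₁)`, `ζ_□̃ = 1` on `supp h_□`, [4] Lemma 2.1 and the two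
located smallness conditions; output through `B9CubeLettersInvWriteDictB.eBlock_kernelFamilyBInv_of_hasMajorant`:
`EBlock (kernelFamilyBInv i B cfg (GAY i parS parB Gp) par) (M₂(Σ_j‖b_j‖)·Bc) ((1−2α)δ₀) U₁`, `Bc = (N·B₀ + A₁ + A₃)·c₁(α)(1 − Θc₁(α))⁻¹ + A₂·c₁(α)(1 − θ_Vc₁(α))⁻¹`.
DEFECT LABEL: the defect family `Σ_□E_□` (resp. `Σ_□E♯_□`) is an (R)-design term, NOT in print; `= 0` for print's `G_□ = (Δ_{loc,□} − DP_□D*)⁻¹` on the cube sequence (p. 409 l. 3–5) and for r05's `GACubeY` letters. [cite: Balaban1985BackgroundPropagators, Thm 3.3 p.399 (3.42) p.397 via Thm 3.10 pp.414–416; Balaban1984PropagatorsII, Prop. 2.2 (2.67) p.234] -/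
theorem eBlock_kernelFamilyBInv_GAY_of_cubes_ofLocalInverse (hι : ∀ s, β i.hN i.D i.hk (ιB s) = s)
    {M₂ : ℝ} (hM₂ : 0 ≤ M₂) (hrepr : ∀ (v : 𝔸) (j : ι), |b.repr v j| ≤ M₂ * ‖v‖)
    (parS : SiteParY 𝔸 i) (parB : BondParY 𝔸 i) (Gp : SiteOpY 𝔸 i)
    (ζ : ↥(cubes i.D.toDomains) → SiteY i → ℝ) (hζ : ∀ c z, hTY i c z ≠ 0 → ζ c z = 1)
    (Oc : ↥(cubes i.D.toDomains) → BondOpY 𝔸 i) (Pl P1l E Et : ↥(cubes i.D.toDomains) → Module.End ℂ (FBondY i → 𝔸))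
    (hP1 : ∀ c, Pl c * cutMulY (hBdY i (hTY i c)) = cutMulY (hBdY i (hTY i c)) * Pl c + P1l c)
    (hdef : ∀ c, cutMulY (hBdY i (hTY i c)) * (deltaLocY i parB (cfg U₁) - Pl c) * Oc c (cfg U₁) * cutMulY (hBdY i (hTY i c)) =
      cutMulY (hBdY i (hTY i c)) * cutMulY (hBdY i (hTY i c)) - E c)
    (hdefT : ∀ c, cutMulY (hBdY i (hTY i c)) * Oc c (cfg U₁) * (deltaLocY i parB (cfg U₁) - Pl c) * cutMulY (hBdY i (hTY i c)) =
      cutMulY (hBdY i (hTY i c)) * cutMulY (hBdY i (hTY i c)) - Et c)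
    (hinvU : IsUnit (deltaAY i parS parB Gp (cfg U₁)))
    (D Ds : Fin (d + 1) → Module.End ℝ (FBondY i → 𝔸)) (hD : ∀ ν Λ, D ν Λ = cdB i (cfg U₁) ν Λ) (hDs : ∀ ν Λ, Ds ν Λ = cdsB i (cfg U₁) ν Λ)
    (Lp : Module.End ℝ (FBondY i → 𝔸)) (hLp : ∀ Λ, Lp Λ = lapB i (cfg U₁) Λ)
    (d' : ℕ) {δ₀ α Θ θV B₀ N A₁ A₂ A₃ : ℝ}
    (S : ↥(cubes i.D.toDomains) → Finset (geo9K i).Site)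
    (KE KF : Fin (d + 1) → ↥(cubes i.D.toDomains) → (geo9K i).Site → (geo9K i).Site → ℝ)
    (KL : ↥(cubes i.D.toDomains) → (geo9K i).Site → (geo9K i).Site → ℝ)
    (hB₀ : 0 ≤ B₀) (hΘ : 0 ≤ Θ) (hθV : 0 ≤ θV) (hN : 0 ≤ N) (hA₁ : 0 ≤ A₁) (hA₂ : 0 ≤ A₂) (hA₃ : 0 ≤ A₃)
    (hαδ : 0 ≤ α * δ₀) (hαδ2 : 0 ≤ (1 - 2 * α) * δ₀)
    (h261 : Ineq261 d' (toB6 (geo9K i) Rr Hp) δ₀ α) (h263 : Ineq263 d' (toB6 (geo9K i) Rr Hp) δ₀ α)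
    (hsmall : Θ * B6.c1 d' δ₀ α < 1) (hsmallV : θV * B6.c1 d' δ₀ α < 1)
    (hT : ∀ c, HasMajorant (g := toB6 (geo9K i) Rr Hp) (fun p : FBondY i × ι => ιB (blkV1 i.hN i.D p.1))
      (mulOp (fun p : FBondY i × ι => hBdY i (hTY i c) p.1) * conj b ((Oc c (cfg U₁)).restrictScalars ℝ) *
        mulOp (fun p : FBondY i × ι => hBdY i (hTY i c) p.1))
      (fun a a' => if a ∈ S c then B₀ * (geo9K i).len a ^ 2 * Real.exp (-(δ₀ * (geo9K i).dist a a')) else 0))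
    (hcnt : ∀ a : (geo9K i).Site, (∑ c, if a ∈ S c then (1 : ℝ) else 0) ≤ N)
    (hR : HasMajorant (g := toB6 (geo9K i) Rr Hp) (fun p : FBondY i × ι => ιB (blkV1 i.hN i.D p.1))
      ((∑ c, conj b ((KhBY i (hTY i c) parB (cfg U₁) * Oc c (cfg U₁) * cutMulY (hBdY i (hTY i c))).restrictScalars ℝ))
        + ∑ c, conj b (((1 - cutMulY (hBdY i (ζ c))) * DPDsY i parS Gp (cfg U₁) *
            (cutMulY (hBdY i (hTY i c)) * Oc c (cfg U₁) * cutMulY (hBdY i (hTY i c)))).restrictScalars ℝ)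
        + ∑ c, conj b ((cutMulY (hBdY i (ζ c)) * (DPDsY i parS Gp (cfg U₁) - Pl c) *
            (cutMulY (hBdY i (hTY i c)) * Oc c (cfg U₁) * cutMulY (hBdY i (hTY i c)))).restrictScalars ℝ)
        + ∑ c, conj b ((cutMulY (hBdY i (ζ c)) * P1l c * Oc c (cfg U₁) * cutMulY (hBdY i (hTY i c))).restrictScalars ℝ)
        + ∑ c, conj b ((E c).restrictScalars ℝ))
      (fun a a' => Θ * Real.exp (-(δ₀ * (geo9K i).dist a a'))))
    (hTE : ∀ ν c, HasMajorant (g := toB6 (geo9K i) Rr Hp) (fun p : FBondY i × ι => ιB (blkV1 i.hN i.D p.1))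
      (conj b (D ν) * (mulOp (fun p : FBondY i × ι => hBdY i (hTY i c) p.1) * conj b ((Oc c (cfg U₁)).restrictScalars ℝ) *
        mulOp (fun p : FBondY i × ι => hBdY i (hTY i c) p.1))) (KE ν c))
    (hKE : ∀ ν a a', (∑ c, KE ν c a a') ≤ A₁ * (geo9K i).len a * Real.exp (-(δ₀ * (geo9K i).dist a a')))
    (hTL : ∀ c, HasMajorant (g := toB6 (geo9K i) Rr Hp) (fun p : FBondY i × ι => ιB (blkV1 i.hN i.D p.1))
      (conj b Lp * (mulOp (fun p : FBondY i × ι => hBdY i (hTY i c) p.1) * conj b ((Oc c (cfg U₁)).restrictScalars ℝ) *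
        mulOp (fun p : FBondY i × ι => hBdY i (hTY i c) p.1))) (KL c))
    (hKL : ∀ a a', (∑ c, KL c a a') ≤ A₃ * 1 * Real.exp (-(δ₀ * (geo9K i).dist a a')))
    (hTF : ∀ ν c, HasMajorant (g := toB6 (geo9K i) Rr Hp) (fun p : FBondY i × ι => ιB (blkV1 i.hN i.D p.1))
      ((mulOp (fun p : FBondY i × ι => hBdY i (hTY i c) p.1) * conj b ((Oc c (cfg U₁)).restrictScalars ℝ) *
        mulOp (fun p : FBondY i × ι => hBdY i (hTY i c) p.1)) * conj b (Ds ν)) (KF ν c))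
    (hKF : ∀ ν a a', (∑ c, KF ν c a a') ≤ A₂ * (geo9K i).len a * Real.exp (-(δ₀ * (geo9K i).dist a a')))
    (hV : HasMajorant (g := toB6 (geo9K i) Rr Hp) (fun p : FBondY i × ι => ιB (blkV1 i.hN i.D p.1))
      (-(∑ c, conj b ((cutMulY (hBdY i (hTY i c)) * Oc c (cfg U₁) * KhBY i (hTY i c) parB (cfg U₁)).restrictScalars ℝ))
        - ∑ c, conj b ((cutMulY (hBdY i (hTY i c)) * Oc c (cfg U₁) * P1l c).restrictScalars ℝ)
        + ∑ c, conj b ((cutMulY (hBdY i (hTY i c)) * Oc c (cfg U₁) * cutMulY (hBdY i (hTY i c)) *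
            (cutMulY (hBdY i (ζ c)) * (DPDsY i parS Gp (cfg U₁) - Pl c))).restrictScalars ℝ)
        + ∑ c, conj b ((cutMulY (hBdY i (hTY i c)) * Oc c (cfg U₁) * cutMulY (hBdY i (hTY i c)) *
            ((1 - cutMulY (hBdY i (ζ c))) * DPDsY i parS Gp (cfg U₁))).restrictScalars ℝ)
        + ∑ c, conj b ((Et c).restrictScalars ℝ))
      (fun a a' => θV * (geo9K i).len a * ((geo9K i).len a')⁻¹ * Real.exp (-(δ₀ * (geo9K i).dist a a')))) :
    EBlock (kernelFamilyBInv i B cfg (GAY i parS parB Gp) par)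
      (M₂ * (∑ j, ‖b j‖) *
        (N * B₀ * B6.c1 d' δ₀ α * (1 - Θ * B6.c1 d' δ₀ α)⁻¹ + A₁ * B6.c1 d' δ₀ α * (1 - Θ * B6.c1 d' δ₀ α)⁻¹ +
          A₂ * B6.c1 d' δ₀ α * (1 - θV * B6.c1 d' δ₀ α)⁻¹ + A₃ * B6.c1 d' δ₀ α * (1 - Θ * B6.c1 d' δ₀ α)⁻¹))
      ((1 - 2 * α) * δ₀) U₁ := by
  -- the member's metric facts (theorems of the k-level V1 family)
  have htri : Triangle254 (toB6 (geo9K i) Rr Hp) :=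
    (B9Thm34Ext.triangle254_toB6_iff (geo9K i) Rr Hp).2 (B9GeoLemma21KLevelV1.geo9K_dist_triangle i)
  have hrefl := B9GeoLemma21KLevelV1.geo9K_dist_self i
  have hdnn := B9GeoLemma21KLevelV1.geo9K_dist_nonneg' i
  have hlenpos := B9GeoLemma21KLevelV1.geo9K_len_pos i
  have hαδ1 : 0 ≤ (1 - α) * δ₀ := by linarith
  -- abbreviations for the constants
  set c : ℝ := B6.c1 d' δ₀ α with hc
  have hc0 : 0 ≤ c := c1_nonneg d' δ₀ α
  have hinv0 : 0 ≤ (1 - Θ * c)⁻¹ := inv_nonneg.mpr (by linarith)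
  have hinvV : 0 ≤ (1 - θV * c)⁻¹ := inv_nonneg.mpr (by linarith)
  have hC₀ : 0 ≤ N * B₀ * c * (1 - Θ * c)⁻¹ := mul_nonneg (mul_nonneg (mul_nonneg hN hB₀) hc0) hinv0
  have hC₁ : 0 ≤ A₁ * c * (1 - Θ * c)⁻¹ := mul_nonneg (mul_nonneg hA₁ hc0) hinv0
  have hC₂ : 0 ≤ A₂ * c * (1 - θV * c)⁻¹ := mul_nonneg (mul_nonneg hA₂ hc0) hinvV
  have hC₃ : 0 ≤ A₃ * c * (1 - Θ * c)⁻¹ := mul_nonneg (mul_nonneg hA₃ hc0) hinv0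
  set Bc : ℝ := N * B₀ * c * (1 - Θ * c)⁻¹ + A₁ * c * (1 - Θ * c)⁻¹ + A₂ * c * (1 - θV * c)⁻¹ + A₃ * c * (1 - Θ * c)⁻¹ with hBc
  have hBc0 : 0 ≤ Bc := by positivity
  have hle₀ : N * B₀ * c * (1 - Θ * c)⁻¹ ≤ Bc := by linarith
  have hle₁ : A₁ * c * (1 - Θ * c)⁻¹ ≤ Bc := by linarith
  have hle₂ : A₂ * c * (1 - θV * c)⁻¹ ≤ Bc := by linarith
  have hle₃ : A₃ * c * (1 - Θ * c)⁻¹ ≤ Bc := by linarith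
  have hrate : ∀ a a' : (geo9K i).Site, (1 - 2 * α) * δ₀ * (geo9K i).dist a a' ≤ (1 - α) * δ₀ * (geo9K i).dist a a' := fun a a' => by
    have h := mul_nonneg hαδ (hdnn a a')
    nlinarith
  -- the letter at `cfg U₁`
  set G : Module.End ℝ (FBondY i → 𝔸) := (GAY i parS parB Gp (cfg U₁)).restrictScalars ℝ with hG
  -- entry 1 (FILE 1-B), entries 2 and 4 (§2 left), entry 3 (§2 right)
  have h0 := hasMajorant_conj_GAY_of_cubes_ofLocalInverse i b ιB d' parS parB Gp (cfg U₁) ζ hζ Oc Pl P1l E hP1 hdef hinvU S hB₀ hΘ hN hαδ1 htri hrefl hdnn h261 h263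
    hsmall hT hcnt hR
  have h1 : ∀ ν : Fin (d + 1), HasMajorant (g := toB6 (geo9K i) Rr Hp) (fun p : FBondY i × ι => ιB (blkV1 i.hN i.D p.1))
      (conj b (D ν) * conj b G)
      (fun a a' => A₁ * c * (1 - Θ * c)⁻¹ * (geo9K i).len a * Real.exp (-((1 - α) * δ₀ * (geo9K i).dist a a'))) := fun ν =>
    hasMajorant_left_conj_GAY_of_cubes_ofLocalInverse i b ιB d' parS parB Gp (cfg U₁) ζ hζ Oc Pl P1l E hP1 hdef hinvU (conj b (D ν)) (fun a => (geo9K i).len a) (KE ν)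
      hA₁ (fun a => (hlenpos a).le) hΘ hαδ1 htri hrefl hdnn h261 h263 hsmall (hTE ν) (hKE ν) hR
  have h3 : HasMajorant (g := toB6 (geo9K i) Rr Hp) (fun p : FBondY i × ι => ιB (blkV1 i.hN i.D p.1)) (conj b Lp * conj b G)
      (fun a a' => A₃ * c * (1 - Θ * c)⁻¹ * 1 * Real.exp (-((1 - α) * δ₀ * (geo9K i).dist a a'))) :=
    hasMajorant_left_conj_GAY_of_cubes_ofLocalInverse i b ιB d' parS parB Gp (cfg U₁) ζ hζ Oc Pl P1l E hP1 hdef hinvU (conj b Lp) (fun _ => (1 : ℝ)) KL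
      hA₃ (fun _ => zero_le_one) hΘ hαδ1 htri hrefl hdnn h261 h263 hsmall hTL hKL hR
  have h2 : ∀ ν : Fin (d + 1), HasMajorant (g := toB6 (geo9K i) Rr Hp) (fun p : FBondY i × ι => ιB (blkV1 i.hN i.D p.1))
      (conj b G * conj b (Ds ν))
      (fun a a' => A₂ * c * (1 - θV * c)⁻¹ * (geo9K i).len a * Real.exp (-((1 - 2 * α) * δ₀ * (geo9K i).dist a a'))) := fun ν =>
    hasMajorant_right_conj_GAY_of_cubes_ofLocalInverse i b ιB d' parS parB Gp (cfg U₁) ζ hζ Oc Pl P1l Et hP1 hdefT hinvU (conj b (Ds ν)) (KF ν) hA₂ hθV hαδ hαδ2 h261 h263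
      hsmallV (hTF ν) (hKF ν) hV
  -- common constant `Bc`, common rate `(1 − 2α)δ₀`, and the dictionary
  refine eBlock_kernelFamilyBInv_of_hasMajorant i b cfg (GAY i parS parB Gp) par (Rr := Rr) (Hp := Hp) ιB hι hM₂ hrepr G (fun _ => rfl)
    D Ds hD hDs Lp hLp hBc0 ?_ ?_ ?_ ?_
  · exact hasMajorant_mono (g := toB6 (geo9K i) Rr Hp) _ h0 fun a a' => kernel_mono hle₀ hBc0 (sq_nonneg _) (hrate a a')
  · exact fun ν => hasMajorant_mono (g := toB6 (geo9K i) Rr Hp) _ (h1 ν) fun a a' => kernel_mono hle₁ hBc0 (hlenpos a).le (hrate a a')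
  · exact fun ν => hasMajorant_mono (g := toB6 (geo9K i) Rr Hp) _ (h2 ν) fun a a' => kernel_mono hle₂ hBc0 (hlenpos a).le le_rfl
  · exact hasMajorant_mono (g := toB6 (geo9K i) Rr Hp) _ h3 fun a a' => kernel_mono hle₃ hBc0 zero_le_one (hrate a a')

end AssemblyCubes

/-! ## §4 The first family of `R` at generic letters: `Σ_□K(h_□)O_□(U₁)h_□` has the majorant `N′·θ₀M⁻¹·e^{−δ₀d}` (3-B §2–§3 re-run) -/

section FirstFamily

variable {B : B9.Backgrounds} (cfg : B.Cfg → CfgY 𝔸 i) (par : BondParY 𝔸 i) {U₁ : B.Cfg}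

omit [DecidableEq ι] [DecidableEq (geo9K i).Site] in
/-- ★ **THE FIRST (3.105) FAMILY, ONE CUBE, j-UNIFORM, ON `S′_□`, GENERIC CUBE LETTER**: for a cube letter `O_□` with its (3.42) block over the class at `U₁` (`hE`),
bi-contractive bond variables and averaging transporters, `η = |c_f|⁻¹` and the plaquette datum `‖U(∂p) − 1‖ ≤ δ̂(L^{lev p₀})⁻²`, the real-coordinate letter
`conj b (K(h_□)O_□(U₁)h_□)` has the majorant `1_{S′_□}(y)·θ₀·M⁻¹·e^{−δ₀d(y,y′)}`, `θ₀ = M₂(Σ‖b_j‖)·θ₃₈₉ᴮ(d,L,B₀,b₁,δ₀,1,2δ̂,δ̂(L²+1),δ̂;0)` — this seat's E′₄-loc (C)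
(`…LocOfInv.hasMajorant_conj_KhBY_hTY_of_eBlockInvB_fac_loc`, letter-generic) with E′₅'s four holonomy data (3-B §2 re-run; our reading of (3.89) with explicit constants).
[cite: Balaban1985BackgroundPropagators, p.414 l.33–35, (3.89) p.409, (3.35) p.396, (3.69) p.404; Balaban1984PropagatorsII, (2.44) p.230, (2.51) p.232] -/
theorem hasMajorant_conj_KhBY_Oc_hTY_fac (hι : ∀ s, β i.hN i.D i.hk (ιB s) = s)
    {M₂ : ℝ} (hM₂ : 0 ≤ M₂) (hrepr : ∀ (v : 𝔸) (j : ι), |b.repr v j| ≤ M₂ * ‖v‖) (hη : etaS i = |i.cf|⁻¹)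
    (Oc : ↥(cubes i.D.toDomains) → BondOpY 𝔸 i) (parB : BondParY 𝔸 i) {B₀ δ₀ : ℝ} (hB₀ : 0 ≤ B₀) (hδ₀ : 0 ≤ δ₀)
    (c : ↥(cubes i.D.toDomains)) (hE : EBlock (kernelFamilyBInv i B cfg (Oc c) par) B₀ δ₀ U₁)
    (hU : ∀ μ x, ‖(cfg U₁ μ x : 𝔸)‖ ≤ 1 ∧ ‖(((cfg U₁ μ x)⁻¹ : 𝔸ˣ) : 𝔸)‖ ≤ 1)
    (hT : ∀ (y : IBondY i) (f : FBondY i), ‖(qT i parB (cfg U₁) y f : 𝔸)‖ ≤ 1 ∧ ‖(((qT i parB (cfg U₁) y f)⁻¹ : 𝔸ˣ) : 𝔸)‖ ≤ 1)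
    {δh : ℝ} (hδh : 0 ≤ δh)
    (hW : ∀ p : PlaqY i, ‖((holY i (cfg U₁) p : 𝔸ˣ) : 𝔸) - 1‖ ≤ δh * ((((ℓ : ℝ) + 1) ^ levY i (chartY i p.src))⁻¹) ^ 2) :
    HasMajorant (g := toB6 (geo9K i) Rr Hp) (fun p : FBondY i × ι => ιB (blkV1 i.hN i.D p.1))
      (conj b ((KhBY i (hTY i c) parB (cfg U₁) * Oc c (cfg U₁) * cutMulY (hBdY i (hTY i c))).restrictScalars ℝ))
      (fun a a' => if a ∈ Finset.univ.filter (fun a : IBondY i => ∃ y ∈ QT i.D (B9GeoLemma21KLevelV1.one_le_Mh i) (four_le_P' i) c,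
          (((bondT i.D).dist (β i.hN i.D i.hk a) y : ℕ) : ℝ) ≤ 2 * (ℓ : ℝ) + 6)
        then M₂ * (∑ j, ‖b j‖) * theta389B d ℓ B₀ b₁ δ₀ 1 (2 * δh) (δh * (((ℓ : ℝ) + 1) ^ 2 + 1)) δh 0 * ((geo9K i).M)⁻¹
          * Real.exp (-(δ₀ * (geo9K i).dist a a')) else 0) := by
  classical
  obtain ⟨_, hMh2, hR, _⟩ := side_conditions i
  refine hasMajorant_conj_KhBY_hTY_of_eBlockInvB_fac_loc i b cfg (Oc c) par (Rr := Rr) (Hp := Hp) hE hM₂ hrepr c parB hB₀ hδ₀ hη ιB hι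
    hU hT (by positivity) zero_le_one (by positivity) hδh
    (hP_of_plaquettes i (cfg U₁) hU hδh hW) (hRe_of_bicontractive i (cfg U₁) hU) (hKc_of_plaquettes i (cfg U₁) hU hδh hW) (hI_of_plaquettes i (cfg U₁) hU hW)
    _ (fun Λ => rfl) _ fun a ha => ?_
  obtain ⟨u, hu, hdu⟩ := ha
  exact Finset.mem_filter.2 ⟨Finset.mem_univ _, blkOf i.D.toDomains u, blkOf_mem_QT_of_hT_ne_zero hMh2 hR (four_le_P' i) c hu, hdu⟩

omit [DecidableEq ι] [DecidableEq (geo9K i).Site] in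
/-- ★ **`Σ_□K(h_□)O_□(U₁)h_□` HAS THE MAJORANT `N′·θ₀M⁻¹·e^{−δ₀d}`, `N′ = 3·5^{d+1}·e^{αδ₀(2L+4)}·c₁(α)`, GENERIC CUBE LETTERS** — the first family of the remainder
`R` of (3.105) summed over the cube cover of record in real coordinates (3-B §3 re-run; [4] p. 232 «A summation preserves it also»; localisation weights `1_{S′_□}` of
overlap `N′`, `B9Thm310CommutatorSum.sum_indicator_nearQT_le`); `θ₀` is ONE constant for the cubes of every level, so the family is `O(M⁻¹)` uniformly in `k`.
[cite: Balaban1985BackgroundPropagators, (3.105) p.414, (3.89) p.409, p.410 l.2–3; Balaban1984PropagatorsII, (2.51)–(2.52) p.232, Lemma 2.1 (2.61) p.234, p.235] -/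
theorem hasMajorant_sum_conj_KhBY_Oc_hTY (hι : ∀ s, β i.hN i.D i.hk (ιB s) = s)
    {M₂ : ℝ} (hM₂ : 0 ≤ M₂) (hrepr : ∀ (v : 𝔸) (j : ι), |b.repr v j| ≤ M₂ * ‖v‖) (hη : etaS i = |i.cf|⁻¹)
    (Oc : ↥(cubes i.D.toDomains) → BondOpY 𝔸 i) (parB : BondParY 𝔸 i) {B₀ δ₀ : ℝ} (hB₀ : 0 ≤ B₀) (hδ₀ : 0 ≤ δ₀)
    (hE : ∀ c : ↥(cubes i.D.toDomains), EBlock (kernelFamilyBInv i B cfg (Oc c) par) B₀ δ₀ U₁)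
    (hU : ∀ μ x, ‖(cfg U₁ μ x : 𝔸)‖ ≤ 1 ∧ ‖(((cfg U₁ μ x)⁻¹ : 𝔸ˣ) : 𝔸)‖ ≤ 1)
    (hT : ∀ (y : IBondY i) (f : FBondY i), ‖(qT i parB (cfg U₁) y f : 𝔸)‖ ≤ 1 ∧ ‖(((qT i parB (cfg U₁) y f)⁻¹ : 𝔸ˣ) : 𝔸)‖ ≤ 1)
    {δh : ℝ} (hδh : 0 ≤ δh)
    (hW : ∀ p : PlaqY i, ‖((holY i (cfg U₁) p : 𝔸ˣ) : 𝔸) - 1‖ ≤ δh * ((((ℓ : ℝ) + 1) ^ levY i (chartY i p.src))⁻¹) ^ 2)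
    (d' : ℕ) {α : ℝ} (hαδ : 0 ≤ α * δ₀) (h261 : Ineq261 d' (toB6 (geo9K i) Rr Hp) δ₀ α) :
    HasMajorant (g := toB6 (geo9K i) Rr Hp) (fun p : FBondY i × ι => ιB (blkV1 i.hN i.D p.1))
      (∑ c : ↥(cubes i.D.toDomains),
        conj b ((KhBY i (hTY i c) parB (cfg U₁) * Oc c (cfg U₁) * cutMulY (hBdY i (hTY i c))).restrictScalars ℝ))
      (fun a a' => (3 * 5 ^ (d + 1) * (Real.exp (α * δ₀ * (2 * (ℓ : ℝ) + 6)) * B6.c1 d' δ₀ α)) *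
          (M₂ * (∑ j, ‖b j‖) * theta389B d ℓ B₀ b₁ δ₀ 1 (2 * δh) (δh * (((ℓ : ℝ) + 1) ^ 2 + 1)) δh 0 * ((geo9K i).M)⁻¹) *
        Real.exp (-(δ₀ * (geo9K i).dist a a'))) := by
  classical
  have hSb : 0 ≤ ∑ j, ‖b j‖ := Finset.sum_nonneg fun _ _ => norm_nonneg _
  have hθ0 : ∀ a : IBondY i, 0 ≤ (M₂ * (∑ j, ‖b j‖) * theta389B d ℓ B₀ b₁ δ₀ 1 (2 * δh) (δh * (((ℓ : ℝ) + 1) ^ 2 + 1)) δh 0 * ((geo9K i).M)⁻¹) := fun a => mul_nonneg (mul_nonneg (mul_nonneg hM₂ hSb)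
    (theta389B_nonneg d ℓ hB₀ (b1_pos i a).le zero_le_one (by positivity) (by positivity) hδh δ₀ 0))
    (inv_nonneg.2 (B9GeoLemma21KLevelV1.geo9K_M_nonneg i))
  -- [4] p. 232 «A summation preserves it also»: the per-cube majorants of §2 add up
  have hsum := B9Thm37Sum.hasMajorant_finsetSum (G := toB6 (geo9K i) Rr Hp) (fun p : FBondY i × ι => ιB (blkV1 i.hN i.D p.1))
    (Finset.univ : Finset ↥(cubes i.D.toDomains)) _ _
    fun c _ => hasMajorant_conj_KhBY_Oc_hTY_fac i b ιB cfg par (Rr := Rr) (Hp := Hp) hι hM₂ hrepr hη Oc parB hB₀ hδ₀ c (hE c) hU hT hδh hW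
  refine hasMajorant_mono (g := toB6 (geo9K i) Rr Hp) _ hsum fun a a' => ?_
  -- the localisation weights factor out; their sum is the overlap count of §1
  have hE0 : 0 ≤ (M₂ * (∑ j, ‖b j‖) * theta389B d ℓ B₀ b₁ δ₀ 1 (2 * δh) (δh * (((ℓ : ℝ) + 1) ^ 2 + 1)) δh 0 * ((geo9K i).M)⁻¹) * Real.exp (-(δ₀ * (geo9K i).dist a a')) := mul_nonneg (hθ0 a) (Real.exp_nonneg _)
  have hterm : ∀ c : ↥(cubes i.D.toDomains),
      (if a ∈ Finset.univ.filter (fun a : IBondY i => ∃ y ∈ QT i.D (B9GeoLemma21KLevelV1.one_le_Mh i) (four_le_P' i) c,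
          (((bondT i.D).dist (β i.hN i.D i.hk a) y : ℕ) : ℝ) ≤ 2 * (ℓ : ℝ) + 6)
        then (M₂ * (∑ j, ‖b j‖) * theta389B d ℓ B₀ b₁ δ₀ 1 (2 * δh) (δh * (((ℓ : ℝ) + 1) ^ 2 + 1)) δh 0 * ((geo9K i).M)⁻¹) * Real.exp (-(δ₀ * (geo9K i).dist a a')) else 0) =
      (if (∃ y ∈ QT i.D (B9GeoLemma21KLevelV1.one_le_Mh i) (four_le_P' i) c,
          (((bondT i.D).dist (β i.hN i.D i.hk a) y : ℕ) : ℝ) ≤ 2 * (ℓ : ℝ) + 6) then (1 : ℝ) else 0) *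
        ((M₂ * (∑ j, ‖b j‖) * theta389B d ℓ B₀ b₁ δ₀ 1 (2 * δh) (δh * (((ℓ : ℝ) + 1) ^ 2 + 1)) δh 0 * ((geo9K i).M)⁻¹) * Real.exp (-(δ₀ * (geo9K i).dist a a'))) := by
    intro c
    by_cases h : ∃ y ∈ QT i.D (B9GeoLemma21KLevelV1.one_le_Mh i) (four_le_P' i) c,
        (((bondT i.D).dist (β i.hN i.D i.hk a) y : ℕ) : ℝ) ≤ 2 * (ℓ : ℝ) + 6
    · have hm : a ∈ Finset.univ.filter (fun a : IBondY i => ∃ y ∈ QT i.D (B9GeoLemma21KLevelV1.one_le_Mh i) (four_le_P' i) c,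
          (((bondT i.D).dist (β i.hN i.D i.hk a) y : ℕ) : ℝ) ≤ 2 * (ℓ : ℝ) + 6) := Finset.mem_filter.2 ⟨Finset.mem_univ (α := IBondY i) a, h⟩
      rw [if_pos hm, if_pos h, one_mul]
    · have hm : a ∉ Finset.univ.filter (fun a : IBondY i => ∃ y ∈ QT i.D (B9GeoLemma21KLevelV1.one_le_Mh i) (four_le_P' i) c,
          (((bondT i.D).dist (β i.hN i.D i.hk a) y : ℕ) : ℝ) ≤ 2 * (ℓ : ℝ) + 6) := fun hm => h (Finset.mem_filter.1 hm).2
      rw [if_neg hm, if_neg h, zero_mul]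
  rw [Finset.sum_congr rfl fun c _ => hterm c, ← Finset.sum_mul]
  calc (∑ c : ↥(cubes i.D.toDomains), if (∃ y ∈ QT i.D (B9GeoLemma21KLevelV1.one_le_Mh i) (four_le_P' i) c,
          (((bondT i.D).dist (β i.hN i.D i.hk a) y : ℕ) : ℝ) ≤ 2 * (ℓ : ℝ) + 6) then (1 : ℝ) else 0) *
        ((M₂ * (∑ j, ‖b j‖) * theta389B d ℓ B₀ b₁ δ₀ 1 (2 * δh) (δh * (((ℓ : ℝ) + 1) ^ 2 + 1)) δh 0 * ((geo9K i).M)⁻¹) * Real.exp (-(δ₀ * (geo9K i).dist a a')))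
      ≤ (3 * 5 ^ (d + 1) * (Real.exp (α * δ₀ * (2 * (ℓ : ℝ) + 6)) * B6.c1 d' δ₀ α)) *
        ((M₂ * (∑ j, ‖b j‖) * theta389B d ℓ B₀ b₁ δ₀ 1 (2 * δh) (δh * (((ℓ : ℝ) + 1) ^ 2 + 1)) δh 0 * ((geo9K i).M)⁻¹) * Real.exp (-(δ₀ * (geo9K i).dist a a'))) :=
        mul_le_mul_of_nonneg_right (sum_indicator_nearQT_le i ιB hι d' hαδ h261 a) hE0
    _ = _ := by ring

end FirstFamily

/-! ## §5 (3.42)₁ at the cover of record, generic letters, first family discharged (6-B §1–§2 re-run) -/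

section Generic

variable {Gb : B6.Geometry} {X : Type}

/-- bookkeeping ([4] p. 232 «A summation preserves it also»): a majorant `Θ₁·E` of the first family `A` and a majorant `Θ′·E` of the sum `B + C + D + F` of the other
families give the five-family sum `A + B + C + D + F` the majorant `(Θ₁ + Θ′)·E` (the five-term twin of 6-B's `hasMajorant_add4_of_head`).
[cite: Balaban1984PropagatorsII, (2.51)–(2.52) p.232; Balaban1985BackgroundPropagators, (3.105) p.414] -/
theorem hasMajorant_add5_of_head (blk : X → Gb.Site) {A B C D F : Module.End ℝ (X → ℝ)} {Θ₁ Θ' : ℝ} {E : Gb.Site → Gb.Site → ℝ}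
    (h1 : HasMajorant blk A (fun a a' => Θ₁ * E a a')) (h2 : HasMajorant blk (B + C + D + F) (fun a a' => Θ' * E a a')) :
    HasMajorant blk (A + B + C + D + F) (fun a a' => (Θ₁ + Θ') * E a a') := by
  have he : A + B + C + D + F = A + (B + C + D + F) := by abel
  rw [he]
  exact hasMajorant_mono blk (hasMajorant_add blk h1 h2) fun a a' => le_of_eq (by ring)

end Generic

section Cover

variable {B : B9.Backgrounds} (cfg : B.Cfg → CfgY 𝔸 i) (par : BondParY 𝔸 i) {U₁ : B.Cfg}

/-- ★★ **THE (3.42)₁ MAJORANT OF `conj b G(U)` AT THE COVER OF RECORD, GENERIC CUBE LETTERS, FIRST FAMILY OF `R` DISCHARGED** (6-B §2 re-run): §1 at the sets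
`SQT □` (overlap `3·5^{d+1}`, p21's `hcnt_SQT`), the cube terms' majorants READ off the letters' blocks `hE` (`hT_of_eBlockInvB_cube`, `B₀ ↦ M₂(Σ‖b_j‖)B₀`), the first
family by §4 (`Θ₁ = 3·5^{d+1}·e^{αδ₀(2L+4)}·c₁(α)·M₂(Σ‖b_j‖)·θ₃₈₉ᴮ(…)·M⁻¹`) and the displayed majorant `Θ′e^{−δ₀d}` of families 2–4 PLUS the defect family (`hrest`);
the LEFT defect law `hdef`, `IsUnit Δ_a(U₁)`, bi-contractivity, `η = |c_f|⁻¹`, the plaquette datum, [4] Lemma 2.1, `(Θ₁ + Θ′)·c₁(α) < 1`.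
DEFECT LABEL: the defect family `Σ_□E_□` (resp. `Σ_□E♯_□`) is an (R)-design term, NOT in print; `= 0` for print's `G_□ = (Δ_{loc,□} − DP_□D*)⁻¹` on the cube sequence (p. 409 l. 3–5) and for r05's `GACubeY` letters. [cite: Balaban1985BackgroundPropagators, Thm 3.10 p.416 + (3.105)–(3.106) p.414 ⇒ Thm 3.3 p.399 (3.42)₁ p.397; Balaban1984PropagatorsII, Prop. 2.2 (2.64)–(2.66) p.234] -/
theorem hasMajorant_conj_GAY_of_localInverse (hι : ∀ s, β i.hN i.D i.hk (ιB s) = s)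
    {M₂ : ℝ} (hM₂ : 0 ≤ M₂) (hrepr : ∀ (v : 𝔸) (j : ι), |b.repr v j| ≤ M₂ * ‖v‖) (hη : etaS i = |i.cf|⁻¹) (hb₁ : 0 ≤ b₁)
    (d' : ℕ) {δ₀ α Θ' B₀ δh : ℝ}
    (parS : SiteParY 𝔸 i) (parB : BondParY 𝔸 i) (Gp : SiteOpY 𝔸 i)
    (ζ : ↥(cubes i.D.toDomains) → SiteY i → ℝ) (hζ : ∀ c z, hTY i c z ≠ 0 → ζ c z = 1)
    (Oc : ↥(cubes i.D.toDomains) → BondOpY 𝔸 i) (Pl P1l E : ↥(cubes i.D.toDomains) → Module.End ℂ (FBondY i → 𝔸))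
    (hP1 : ∀ c, Pl c * cutMulY (hBdY i (hTY i c)) = cutMulY (hBdY i (hTY i c)) * Pl c + P1l c)
    (hdef : ∀ c, cutMulY (hBdY i (hTY i c)) * (deltaLocY i parB (cfg U₁) - Pl c) * Oc c (cfg U₁) * cutMulY (hBdY i (hTY i c)) =
      cutMulY (hBdY i (hTY i c)) * cutMulY (hBdY i (hTY i c)) - E c)
    (hinvU : IsUnit (deltaAY i parS parB Gp (cfg U₁)))
    (hB₀ : 0 ≤ B₀) (hδ₀ : 0 ≤ δ₀) (hΘ' : 0 ≤ Θ') (hδh : 0 ≤ δh) (hαδ : 0 ≤ α * δ₀) (hαδ1 : 0 ≤ (1 - α) * δ₀)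
    (htri : Triangle254 (toB6 (geo9K i) Rr Hp)) (hrefl : ∀ y : (geo9K i).Site, (geo9K i).dist y y = 0)
    (hdnn : ∀ y y' : (geo9K i).Site, 0 ≤ (geo9K i).dist y y')
    (h261 : Ineq261 d' (toB6 (geo9K i) Rr Hp) δ₀ α) (h263 : Ineq263 d' (toB6 (geo9K i) Rr Hp) δ₀ α)
    (hsmall : ((3 * 5 ^ (d + 1) * (Real.exp (α * δ₀ * (2 * (ℓ : ℝ) + 6)) * B6.c1 d' δ₀ α)) *
        (M₂ * (∑ j, ‖b j‖) * theta389B d ℓ B₀ b₁ δ₀ 1 (2 * δh) (δh * (((ℓ : ℝ) + 1) ^ 2 + 1)) δh 0 * ((geo9K i).M)⁻¹) + Θ') * B6.c1 d' δ₀ α < 1)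
    (hE : ∀ c : ↥(cubes i.D.toDomains), EBlock (kernelFamilyBInv i B cfg (Oc c) par) B₀ δ₀ U₁)
    (hU : ∀ μ x, ‖(cfg U₁ μ x : 𝔸)‖ ≤ 1 ∧ ‖(((cfg U₁ μ x)⁻¹ : 𝔸ˣ) : 𝔸)‖ ≤ 1)
    (hT : ∀ (y : IBondY i) (f : FBondY i), ‖(qT i parB (cfg U₁) y f : 𝔸)‖ ≤ 1 ∧ ‖(((qT i parB (cfg U₁) y f)⁻¹ : 𝔸ˣ) : 𝔸)‖ ≤ 1)
    (hW : ∀ p : PlaqY i, ‖((holY i (cfg U₁) p : 𝔸ˣ) : 𝔸) - 1‖ ≤ δh * ((((ℓ : ℝ) + 1) ^ levY i (chartY i p.src))⁻¹) ^ 2)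
    (hrest : HasMajorant (g := toB6 (geo9K i) Rr Hp) (fun p : FBondY i × ι => ιB (blkV1 i.hN i.D p.1))
      (∑ c, conj b (((1 - cutMulY (hBdY i (ζ c))) * DPDsY i parS Gp (cfg U₁) *
            (cutMulY (hBdY i (hTY i c)) * Oc c (cfg U₁) * cutMulY (hBdY i (hTY i c)))).restrictScalars ℝ)
        + ∑ c, conj b ((cutMulY (hBdY i (ζ c)) * (DPDsY i parS Gp (cfg U₁) - Pl c) *
            (cutMulY (hBdY i (hTY i c)) * Oc c (cfg U₁) * cutMulY (hBdY i (hTY i c)))).restrictScalars ℝ)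
        + ∑ c, conj b ((cutMulY (hBdY i (ζ c)) * P1l c * Oc c (cfg U₁) * cutMulY (hBdY i (hTY i c))).restrictScalars ℝ)
        + ∑ c, conj b ((E c).restrictScalars ℝ))
      (fun a a' => Θ' * Real.exp (-(δ₀ * (geo9K i).dist a a')))) :
    HasMajorant (g := toB6 (geo9K i) Rr Hp) (fun p : FBondY i × ι => ιB (blkV1 i.hN i.D p.1))
      (conj b ((GAY i parS parB Gp (cfg U₁)).restrictScalars ℝ))
      (fun a a' => (3 * 5 ^ (d + 1)) * (M₂ * (∑ j, ‖b j‖) * B₀) * B6.c1 d' δ₀ α *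
          (1 - ((3 * 5 ^ (d + 1) * (Real.exp (α * δ₀ * (2 * (ℓ : ℝ) + 6)) * B6.c1 d' δ₀ α)) *
            (M₂ * (∑ j, ‖b j‖) * theta389B d ℓ B₀ b₁ δ₀ 1 (2 * δh) (δh * (((ℓ : ℝ) + 1) ^ 2 + 1)) δh 0 * ((geo9K i).M)⁻¹) + Θ') *
            B6.c1 d' δ₀ α)⁻¹ * (geo9K i).len a ^ 2 *
        Real.exp (-((1 - α) * δ₀ * (geo9K i).dist a a'))) := by
  have hSb : 0 ≤ ∑ j, ‖b j‖ := Finset.sum_nonneg fun _ _ => norm_nonneg _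
  have hΘ₁ : 0 ≤ (3 * 5 ^ (d + 1) * (Real.exp (α * δ₀ * (2 * (ℓ : ℝ) + 6)) * B6.c1 d' δ₀ α)) *
      (M₂ * (∑ j, ‖b j‖) * theta389B d ℓ B₀ b₁ δ₀ 1 (2 * δh) (δh * (((ℓ : ℝ) + 1) ^ 2 + 1)) δh 0 * ((geo9K i).M)⁻¹) :=
    mul_nonneg (mul_nonneg (by positivity) (mul_nonneg (Real.exp_nonneg _) (c1_nonneg d' δ₀ α)))
      (mul_nonneg (mul_nonneg (mul_nonneg hM₂ hSb) (theta389B_nonneg d ℓ hB₀ hb₁ zero_le_one (by positivity) (by positivity) hδh δ₀ 0))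
        (inv_nonneg.2 (B9GeoLemma21KLevelV1.geo9K_M_nonneg i)))
  exact hasMajorant_conj_GAY_of_cubes_ofLocalInverse i b ιB d' parS parB Gp (cfg U₁) ζ hζ Oc Pl P1l E hP1 hdef hinvU (SQT i)
    (mul_nonneg (mul_nonneg hM₂ hSb) hB₀) (add_nonneg hΘ₁ hΘ') (by positivity) hαδ1 htri hrefl hdnn h261 h263 hsmall
    (fun c => hT_of_eBlockInvB_cube i b ιB cfg hι hM₂ hrepr (Oc c) par hB₀ (hE c) c) (hcnt_SQT i)
    (hasMajorant_add5_of_head _ (hasMajorant_sum_conj_KhBY_Oc_hTY i b ιB cfg par hι hM₂ hrepr hη Oc parB hB₀ hδ₀ hE hU hT hδh hW d' hαδ h261) hrest)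

/-- ★★ **(3.42)₁ FOR def-Y's `G(U)` AS THE `e 0` ENTRY OF `kernelFamilyBInv … (GAY i parS parB Gp) …` OVER THE CLASS AT `U₁`, GENERIC CUBE LETTERS** — constant
`M₂(Σ‖b_j‖)·3·5^{d+1}·M₂(Σ‖b_j‖)B₀·c₁(α)·(1 − (Θ₁ + Θ′)c₁(α))⁻¹`, rate `(1−α)δ₀` (6-B §2 re-run through `B9Thm310GTorusRegular.e0_kernelFamilyBInv_le_of_hasMajorant`).
[cite: Balaban1985BackgroundPropagators, Thm 3.3 p.399 (3.42)₁ p.397 via Thm 3.10 pp.414–416] -/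
theorem e0_kernelFamilyBInv_GAY_le_of_localInverse (hι : ∀ s, β i.hN i.D i.hk (ιB s) = s)
    {M₂ : ℝ} (hM₂ : 0 ≤ M₂) (hrepr : ∀ (v : 𝔸) (j : ι), |b.repr v j| ≤ M₂ * ‖v‖) (hη : etaS i = |i.cf|⁻¹) (hb₁ : 0 ≤ b₁)
    (d' : ℕ) {δ₀ α Θ' B₀ δh : ℝ}
    (parS : SiteParY 𝔸 i) (parB : BondParY 𝔸 i) (Gp : SiteOpY 𝔸 i)
    (ζ : ↥(cubes i.D.toDomains) → SiteY i → ℝ) (hζ : ∀ c z, hTY i c z ≠ 0 → ζ c z = 1)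
    (Oc : ↥(cubes i.D.toDomains) → BondOpY 𝔸 i) (Pl P1l E : ↥(cubes i.D.toDomains) → Module.End ℂ (FBondY i → 𝔸))
    (hP1 : ∀ c, Pl c * cutMulY (hBdY i (hTY i c)) = cutMulY (hBdY i (hTY i c)) * Pl c + P1l c)
    (hdef : ∀ c, cutMulY (hBdY i (hTY i c)) * (deltaLocY i parB (cfg U₁) - Pl c) * Oc c (cfg U₁) * cutMulY (hBdY i (hTY i c)) =
      cutMulY (hBdY i (hTY i c)) * cutMulY (hBdY i (hTY i c)) - E c)
    (hinvU : IsUnit (deltaAY i parS parB Gp (cfg U₁)))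
    (hB₀ : 0 ≤ B₀) (hδ₀ : 0 ≤ δ₀) (hΘ' : 0 ≤ Θ') (hδh : 0 ≤ δh) (hαδ : 0 ≤ α * δ₀) (hαδ1 : 0 ≤ (1 - α) * δ₀)
    (htri : Triangle254 (toB6 (geo9K i) Rr Hp)) (hrefl : ∀ y : (geo9K i).Site, (geo9K i).dist y y = 0)
    (hdnn : ∀ y y' : (geo9K i).Site, 0 ≤ (geo9K i).dist y y')
    (h261 : Ineq261 d' (toB6 (geo9K i) Rr Hp) δ₀ α) (h263 : Ineq263 d' (toB6 (geo9K i) Rr Hp) δ₀ α)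
    (hsmall : ((3 * 5 ^ (d + 1) * (Real.exp (α * δ₀ * (2 * (ℓ : ℝ) + 6)) * B6.c1 d' δ₀ α)) *
        (M₂ * (∑ j, ‖b j‖) * theta389B d ℓ B₀ b₁ δ₀ 1 (2 * δh) (δh * (((ℓ : ℝ) + 1) ^ 2 + 1)) δh 0 * ((geo9K i).M)⁻¹) + Θ') * B6.c1 d' δ₀ α < 1)
    (hE : ∀ c : ↥(cubes i.D.toDomains), EBlock (kernelFamilyBInv i B cfg (Oc c) par) B₀ δ₀ U₁)
    (hU : ∀ μ x, ‖(cfg U₁ μ x : 𝔸)‖ ≤ 1 ∧ ‖(((cfg U₁ μ x)⁻¹ : 𝔸ˣ) : 𝔸)‖ ≤ 1)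
    (hT : ∀ (y : IBondY i) (f : FBondY i), ‖(qT i parB (cfg U₁) y f : 𝔸)‖ ≤ 1 ∧ ‖(((qT i parB (cfg U₁) y f)⁻¹ : 𝔸ˣ) : 𝔸)‖ ≤ 1)
    (hW : ∀ p : PlaqY i, ‖((holY i (cfg U₁) p : 𝔸ˣ) : 𝔸) - 1‖ ≤ δh * ((((ℓ : ℝ) + 1) ^ levY i (chartY i p.src))⁻¹) ^ 2)
    (hrest : HasMajorant (g := toB6 (geo9K i) Rr Hp) (fun p : FBondY i × ι => ιB (blkV1 i.hN i.D p.1))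
      (∑ c, conj b (((1 - cutMulY (hBdY i (ζ c))) * DPDsY i parS Gp (cfg U₁) *
            (cutMulY (hBdY i (hTY i c)) * Oc c (cfg U₁) * cutMulY (hBdY i (hTY i c)))).restrictScalars ℝ)
        + ∑ c, conj b ((cutMulY (hBdY i (ζ c)) * (DPDsY i parS Gp (cfg U₁) - Pl c) *
            (cutMulY (hBdY i (hTY i c)) * Oc c (cfg U₁) * cutMulY (hBdY i (hTY i c)))).restrictScalars ℝ)
        + ∑ c, conj b ((cutMulY (hBdY i (ζ c)) * P1l c * Oc c (cfg U₁) * cutMulY (hBdY i (hTY i c))).restrictScalars ℝ)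
        + ∑ c, conj b ((E c).restrictScalars ℝ))
      (fun a a' => Θ' * Real.exp (-(δ₀ * (geo9K i).dist a a'))))
    (lam : (geo9K i).Loc) (y y' : IBondY i) (hs : (geo9K i).suppIn lam y') :
    (kernelFamilyBInv i B cfg (GAY i parS parB Gp) par).e 0 U₁ lam y ≤
      M₂ * (∑ j, ‖b j‖) * ((3 * 5 ^ (d + 1)) * (M₂ * (∑ j, ‖b j‖) * B₀) * B6.c1 d' δ₀ α *
          (1 - ((3 * 5 ^ (d + 1) * (Real.exp (α * δ₀ * (2 * (ℓ : ℝ) + 6)) * B6.c1 d' δ₀ α)) *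
            (M₂ * (∑ j, ‖b j‖) * theta389B d ℓ B₀ b₁ δ₀ 1 (2 * δh) (δh * (((ℓ : ℝ) + 1) ^ 2 + 1)) δh 0 * ((geo9K i).M)⁻¹) + Θ') *
            B6.c1 d' δ₀ α)⁻¹) *
        (geo9K i).len y ^ 2 * Real.exp (-((1 - α) * δ₀ * (geo9K i).dist y y')) * (geo9K i).supNorm lam := by
  have hSb : 0 ≤ ∑ j, ‖b j‖ := Finset.sum_nonneg fun _ _ => norm_nonneg _
  have hC : 0 ≤ (3 * 5 ^ (d + 1)) * (M₂ * (∑ j, ‖b j‖) * B₀) * B6.c1 d' δ₀ α *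
      (1 - ((3 * 5 ^ (d + 1) * (Real.exp (α * δ₀ * (2 * (ℓ : ℝ) + 6)) * B6.c1 d' δ₀ α)) *
        (M₂ * (∑ j, ‖b j‖) * theta389B d ℓ B₀ b₁ δ₀ 1 (2 * δh) (δh * (((ℓ : ℝ) + 1) ^ 2 + 1)) δh 0 * ((geo9K i).M)⁻¹) + Θ') *
        B6.c1 d' δ₀ α)⁻¹ :=
    mul_nonneg (mul_nonneg (mul_nonneg (by positivity) (mul_nonneg (mul_nonneg hM₂ hSb) hB₀)) (c1_nonneg d' δ₀ α))
      (inv_nonneg.2 (sub_nonneg.2 hsmall.le))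
  exact e0_kernelFamilyBInv_le_of_hasMajorant i b ιB cfg hι hM₂ hrepr (GAY i parS parB Gp) par ((GAY i parS parB Gp (cfg U₁)).restrictScalars ℝ)
    (fun _ => rfl) hC
    (hasMajorant_conj_GAY_of_localInverse i b ιB cfg par hι hM₂ hrepr hη hb₁ d' parS parB Gp ζ hζ Oc Pl P1l E hP1 hdef hinvU hB₀ hδ₀ hΘ' hδh hαδ hαδ1
      htri hrefl hdnn h261 h263 hsmall hE hU hT hW hrest)
    lam y y' hs

end Cover

/-! ## §6 All four sup-entries (3.42) at the cover of record, generic letters, first family discharged — the consumer-facing block (6-B §3 re-run) -/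

section Block

variable {B : B9.Backgrounds} (cfg : B.Cfg → CfgY 𝔸 i) (par : BondParY 𝔸 i) {U₁ : B.Cfg}

/-- ★★★ **THEOREM 3.10 ⇒ THE (3.42) BLOCK OF `kernelFamilyBInv … (GAY i parS parB Gp) …` OVER THE CLASS AT `U₁`, AT THE COVER OF RECORD, WITH THE CUBE LETTERS AN
ARBITRARY FAMILY `O_□` — THE CONSUMER-FACING FORM OF THE (QB1) RE-CUT** (6-B §3 re-run; bond twin of p21's `eBlock_kernelFamilySInv_Gp_of_localInverse`).  Displayed: the
letters' (3.42) blocks `hE` at `U₁` (Cor. 3.6 ∕ Thm 3.3 for `O_□` — the M5.1b-G hand's output), the two defect laws `hdef`∕`hdefT` (exact, `E = E♯ = 0`, for print's letters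
and r05's `GACubeY`: `B9Eq3105OfLocalInverse.hdef_GACubeY`∕`hdefT_GACubeY`), the rest majorant `hrest` (families 2–4 of `R` + the defect family `Σ_□ conj b E_□`), the cube
Leibniz majorants `hTE`∕`hTF`∕`hTL` with their sums, the transposed remainder's `hV` (families 1–4 + `Σ_□ conj b E♯_□`), `hinvU`, bi-contractivity `hU`∕`hT`, the plaquette
datum `hW`, `η = |c_f|⁻¹`, `0 ≤ b₁`, [4] Lemma 2.1, the two smallness conditions.  Output:
`EBlock (kernelFamilyBInv i B cfg (GAY i parS parB Gp) par) (M₂(Σ‖b_j‖)·Bc) ((1−2α)δ₀) U₁`, `Bc` term by term as in 6-B.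
DEFECT LABEL: the defect family `Σ_□E_□` (resp. `Σ_□E♯_□`) is an (R)-design term, NOT in print; `= 0` for print's `G_□ = (Δ_{loc,□} − DP_□D*)⁻¹` on the cube sequence (p. 409 l. 3–5) and for r05's `GACubeY` letters. [cite: Balaban1985BackgroundPropagators, Thm 3.3 p.399 (3.42) p.397 via Thm 3.10 pp.414–416, (3.87) p.409, p.409 l.3–5, p.410 l.2–3; Balaban1984PropagatorsII, Prop. 2.2 (2.67) p.234] -/
theorem eBlock_kernelFamilyBInv_GAY_of_localInverse (hι : ∀ s, β i.hN i.D i.hk (ιB s) = s)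
    {M₂ : ℝ} (hM₂ : 0 ≤ M₂) (hrepr : ∀ (v : 𝔸) (j : ι), |b.repr v j| ≤ M₂ * ‖v‖) (hη : etaS i = |i.cf|⁻¹) (hb₁ : 0 ≤ b₁)
    (parS : SiteParY 𝔸 i) (parB : BondParY 𝔸 i) (Gp : SiteOpY 𝔸 i)
    (ζ : ↥(cubes i.D.toDomains) → SiteY i → ℝ) (hζ : ∀ c z, hTY i c z ≠ 0 → ζ c z = 1)
    (Oc : ↥(cubes i.D.toDomains) → BondOpY 𝔸 i) (Pl P1l E Et : ↥(cubes i.D.toDomains) → Module.End ℂ (FBondY i → 𝔸))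
    (hP1 : ∀ c, Pl c * cutMulY (hBdY i (hTY i c)) = cutMulY (hBdY i (hTY i c)) * Pl c + P1l c)
    (hdef : ∀ c, cutMulY (hBdY i (hTY i c)) * (deltaLocY i parB (cfg U₁) - Pl c) * Oc c (cfg U₁) * cutMulY (hBdY i (hTY i c)) =
      cutMulY (hBdY i (hTY i c)) * cutMulY (hBdY i (hTY i c)) - E c)
    (hdefT : ∀ c, cutMulY (hBdY i (hTY i c)) * Oc c (cfg U₁) * (deltaLocY i parB (cfg U₁) - Pl c) * cutMulY (hBdY i (hTY i c)) =
      cutMulY (hBdY i (hTY i c)) * cutMulY (hBdY i (hTY i c)) - Et c)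
    (hinvU : IsUnit (deltaAY i parS parB Gp (cfg U₁)))
    (D Ds : Fin (d + 1) → Module.End ℝ (FBondY i → 𝔸)) (hD : ∀ ν Λ, D ν Λ = cdB i (cfg U₁) ν Λ) (hDs : ∀ ν Λ, Ds ν Λ = cdsB i (cfg U₁) ν Λ)
    (Lp : Module.End ℝ (FBondY i → 𝔸)) (hLp : ∀ Λ, Lp Λ = lapB i (cfg U₁) Λ)
    (d' : ℕ) {δ₀ α Θ' θV B₀ δh A₁ A₂ A₃ : ℝ}
    (KE KF : Fin (d + 1) → ↥(cubes i.D.toDomains) → (geo9K i).Site → (geo9K i).Site → ℝ)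
    (KL : ↥(cubes i.D.toDomains) → (geo9K i).Site → (geo9K i).Site → ℝ)
    (hB₀ : 0 ≤ B₀) (hδ₀ : 0 ≤ δ₀) (hΘ' : 0 ≤ Θ') (hθV : 0 ≤ θV) (hδh : 0 ≤ δh) (hA₁ : 0 ≤ A₁) (hA₂ : 0 ≤ A₂) (hA₃ : 0 ≤ A₃)
    (hαδ : 0 ≤ α * δ₀) (hαδ2 : 0 ≤ (1 - 2 * α) * δ₀)
    (h261 : Ineq261 d' (toB6 (geo9K i) Rr Hp) δ₀ α) (h263 : Ineq263 d' (toB6 (geo9K i) Rr Hp) δ₀ α)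
    (hsmall : ((3 * 5 ^ (d + 1) * (Real.exp (α * δ₀ * (2 * (ℓ : ℝ) + 6)) * B6.c1 d' δ₀ α)) *
        (M₂ * (∑ j, ‖b j‖) * theta389B d ℓ B₀ b₁ δ₀ 1 (2 * δh) (δh * (((ℓ : ℝ) + 1) ^ 2 + 1)) δh 0 * ((geo9K i).M)⁻¹) + Θ') * B6.c1 d' δ₀ α < 1)
    (hsmallV : θV * B6.c1 d' δ₀ α < 1)
    (hE : ∀ c : ↥(cubes i.D.toDomains), EBlock (kernelFamilyBInv i B cfg (Oc c) par) B₀ δ₀ U₁)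
    (hU : ∀ μ x, ‖(cfg U₁ μ x : 𝔸)‖ ≤ 1 ∧ ‖(((cfg U₁ μ x)⁻¹ : 𝔸ˣ) : 𝔸)‖ ≤ 1)
    (hT : ∀ (y : IBondY i) (f : FBondY i), ‖(qT i parB (cfg U₁) y f : 𝔸)‖ ≤ 1 ∧ ‖(((qT i parB (cfg U₁) y f)⁻¹ : 𝔸ˣ) : 𝔸)‖ ≤ 1)
    (hW : ∀ p : PlaqY i, ‖((holY i (cfg U₁) p : 𝔸ˣ) : 𝔸) - 1‖ ≤ δh * ((((ℓ : ℝ) + 1) ^ levY i (chartY i p.src))⁻¹) ^ 2)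
    (hrest : HasMajorant (g := toB6 (geo9K i) Rr Hp) (fun p : FBondY i × ι => ιB (blkV1 i.hN i.D p.1))
      (∑ c, conj b (((1 - cutMulY (hBdY i (ζ c))) * DPDsY i parS Gp (cfg U₁) *
            (cutMulY (hBdY i (hTY i c)) * Oc c (cfg U₁) * cutMulY (hBdY i (hTY i c)))).restrictScalars ℝ)
        + ∑ c, conj b ((cutMulY (hBdY i (ζ c)) * (DPDsY i parS Gp (cfg U₁) - Pl c) *
            (cutMulY (hBdY i (hTY i c)) * Oc c (cfg U₁) * cutMulY (hBdY i (hTY i c)))).restrictScalars ℝ)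
        + ∑ c, conj b ((cutMulY (hBdY i (ζ c)) * P1l c * Oc c (cfg U₁) * cutMulY (hBdY i (hTY i c))).restrictScalars ℝ)
        + ∑ c, conj b ((E c).restrictScalars ℝ))
      (fun a a' => Θ' * Real.exp (-(δ₀ * (geo9K i).dist a a'))))
    (hTE : ∀ ν c, HasMajorant (g := toB6 (geo9K i) Rr Hp) (fun p : FBondY i × ι => ιB (blkV1 i.hN i.D p.1))
      (conj b (D ν) * (mulOp (fun p : FBondY i × ι => hBdY i (hTY i c) p.1) * conj b ((Oc c (cfg U₁)).restrictScalars ℝ) *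
        mulOp (fun p : FBondY i × ι => hBdY i (hTY i c) p.1))) (KE ν c))
    (hKE : ∀ ν a a', (∑ c, KE ν c a a') ≤ A₁ * (geo9K i).len a * Real.exp (-(δ₀ * (geo9K i).dist a a')))
    (hTL : ∀ c, HasMajorant (g := toB6 (geo9K i) Rr Hp) (fun p : FBondY i × ι => ιB (blkV1 i.hN i.D p.1))
      (conj b Lp * (mulOp (fun p : FBondY i × ι => hBdY i (hTY i c) p.1) * conj b ((Oc c (cfg U₁)).restrictScalars ℝ) *
        mulOp (fun p : FBondY i × ι => hBdY i (hTY i c) p.1))) (KL c))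
    (hKL : ∀ a a', (∑ c, KL c a a') ≤ A₃ * 1 * Real.exp (-(δ₀ * (geo9K i).dist a a')))
    (hTF : ∀ ν c, HasMajorant (g := toB6 (geo9K i) Rr Hp) (fun p : FBondY i × ι => ιB (blkV1 i.hN i.D p.1))
      ((mulOp (fun p : FBondY i × ι => hBdY i (hTY i c) p.1) * conj b ((Oc c (cfg U₁)).restrictScalars ℝ) *
        mulOp (fun p : FBondY i × ι => hBdY i (hTY i c) p.1)) * conj b (Ds ν)) (KF ν c))
    (hKF : ∀ ν a a', (∑ c, KF ν c a a') ≤ A₂ * (geo9K i).len a * Real.exp (-(δ₀ * (geo9K i).dist a a')))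
    (hV : HasMajorant (g := toB6 (geo9K i) Rr Hp) (fun p : FBondY i × ι => ιB (blkV1 i.hN i.D p.1))
      (-(∑ c, conj b ((cutMulY (hBdY i (hTY i c)) * Oc c (cfg U₁) * KhBY i (hTY i c) parB (cfg U₁)).restrictScalars ℝ))
        - ∑ c, conj b ((cutMulY (hBdY i (hTY i c)) * Oc c (cfg U₁) * P1l c).restrictScalars ℝ)
        + ∑ c, conj b ((cutMulY (hBdY i (hTY i c)) * Oc c (cfg U₁) * cutMulY (hBdY i (hTY i c)) *
            (cutMulY (hBdY i (ζ c)) * (DPDsY i parS Gp (cfg U₁) - Pl c))).restrictScalars ℝ)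
        + ∑ c, conj b ((cutMulY (hBdY i (hTY i c)) * Oc c (cfg U₁) * cutMulY (hBdY i (hTY i c)) *
            ((1 - cutMulY (hBdY i (ζ c))) * DPDsY i parS Gp (cfg U₁))).restrictScalars ℝ)
        + ∑ c, conj b ((Et c).restrictScalars ℝ))
      (fun a a' => θV * (geo9K i).len a * ((geo9K i).len a')⁻¹ * Real.exp (-(δ₀ * (geo9K i).dist a a')))) :
    EBlock (kernelFamilyBInv i B cfg (GAY i parS parB Gp) par)
      (M₂ * (∑ j, ‖b j‖) *
        ((3 * 5 ^ (d + 1)) * (M₂ * (∑ j, ‖b j‖) * B₀) * B6.c1 d' δ₀ α *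
            (1 - ((3 * 5 ^ (d + 1) * (Real.exp (α * δ₀ * (2 * (ℓ : ℝ) + 6)) * B6.c1 d' δ₀ α)) *
              (M₂ * (∑ j, ‖b j‖) * theta389B d ℓ B₀ b₁ δ₀ 1 (2 * δh) (δh * (((ℓ : ℝ) + 1) ^ 2 + 1)) δh 0 * ((geo9K i).M)⁻¹) + Θ') *
              B6.c1 d' δ₀ α)⁻¹ +
          A₁ * B6.c1 d' δ₀ α *
            (1 - ((3 * 5 ^ (d + 1) * (Real.exp (α * δ₀ * (2 * (ℓ : ℝ) + 6)) * B6.c1 d' δ₀ α)) *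
              (M₂ * (∑ j, ‖b j‖) * theta389B d ℓ B₀ b₁ δ₀ 1 (2 * δh) (δh * (((ℓ : ℝ) + 1) ^ 2 + 1)) δh 0 * ((geo9K i).M)⁻¹) + Θ') *
              B6.c1 d' δ₀ α)⁻¹ +
          A₂ * B6.c1 d' δ₀ α * (1 - θV * B6.c1 d' δ₀ α)⁻¹ +
          A₃ * B6.c1 d' δ₀ α *
            (1 - ((3 * 5 ^ (d + 1) * (Real.exp (α * δ₀ * (2 * (ℓ : ℝ) + 6)) * B6.c1 d' δ₀ α)) *
              (M₂ * (∑ j, ‖b j‖) * theta389B d ℓ B₀ b₁ δ₀ 1 (2 * δh) (δh * (((ℓ : ℝ) + 1) ^ 2 + 1)) δh 0 * ((geo9K i).M)⁻¹) + Θ') *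
              B6.c1 d' δ₀ α)⁻¹))
      ((1 - 2 * α) * δ₀) U₁ := by
  have hSb : 0 ≤ ∑ j, ‖b j‖ := Finset.sum_nonneg fun _ _ => norm_nonneg _
  have hΘ₁ : 0 ≤ (3 * 5 ^ (d + 1) * (Real.exp (α * δ₀ * (2 * (ℓ : ℝ) + 6)) * B6.c1 d' δ₀ α)) *
      (M₂ * (∑ j, ‖b j‖) * theta389B d ℓ B₀ b₁ δ₀ 1 (2 * δh) (δh * (((ℓ : ℝ) + 1) ^ 2 + 1)) δh 0 * ((geo9K i).M)⁻¹) :=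
    mul_nonneg (mul_nonneg (by positivity) (mul_nonneg (Real.exp_nonneg _) (c1_nonneg d' δ₀ α)))
      (mul_nonneg (mul_nonneg (mul_nonneg hM₂ hSb) (theta389B_nonneg d ℓ hB₀ hb₁ zero_le_one (by positivity) (by positivity) hδh δ₀ 0))
        (inv_nonneg.2 (B9GeoLemma21KLevelV1.geo9K_M_nonneg i)))
  exact eBlock_kernelFamilyBInv_GAY_of_cubes_ofLocalInverse i b ιB cfg par hι hM₂ hrepr parS parB Gp ζ hζ Oc Pl P1l E Et hP1 hdef hdefT hinvU
    D Ds hD hDs Lp hLp d' (SQT i) KE KF KL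
    (mul_nonneg (mul_nonneg hM₂ hSb) hB₀) (add_nonneg hΘ₁ hΘ') hθV (by positivity) hA₁ hA₂ hA₃ hαδ hαδ2 h261 h263 hsmall hsmallV
    (fun c => hT_of_eBlockInvB_cube i b ιB cfg hι hM₂ hrepr (Oc c) par hB₀ (hE c) c) (hcnt_SQT i)
    (hasMajorant_add5_of_head _ (hasMajorant_sum_conj_KhBY_Oc_hTY i b ιB cfg par hι hM₂ hrepr hη Oc parB hB₀ hδ₀ hE hU hT hδh hW d' hαδ h261) hrest)
    hTE hKE hTL hKL hTF hKF hV

end Block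


end Literature.MathematicalPhysics.QuantumFieldTheory.Balaban1983to89.B9Thm310GOfLocalInverse

end
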